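import Literature.Analysis.Fourier.PorousFractalUncertaintyProofs
import Literature.Analysis.Fourier.SmoothGridCutoff
import Literature.Analysis.Fourier.FractalUncertaintyPrincipleThm4
import Literature.Analysis.OperatorTheory.L2KernelOperator
import Literature.Analysis.OperatorTheory.CotlarStein
import Mathlib.Analysis.PSeries
import HarnessLib

/-!
# Dyatlov–Jin–Nonnenmacher 2021, Proposition 2.9 from Bourgain–Dyatlov 2018, Theorem 4:
# almost orthogonality (Steps 1–3 and 5 of the printed proof) and the discharge

Topic `Literature/Analysis/Fourier`. Definitions with bodies and theorems; no named fact is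
introduced. This file completes the inline (D-0026) reduction of the named fact
`dyatlovJinNonnenmacher2021_prop_2_9` (`PorousFractalUncertainty.lean`: the fractal uncertainty
principle `‖𝟙_{Ω₋} 𝓕_h 𝟙_{Ω₊}‖ ≤ C h^β` for UNBOUNDED `ν`-porous sets) to the named fact
`bourgainDyatlov2018_thm4` (`FractalUncertaintyPrinciple.lean`):

  `dyatlovJinNonnenmacher2021_prop_2_9_of_bd18 : bourgainDyatlov2018_thm4 → dyatlovJinNonnenmacher2021_prop_2_9`,

and, since [BourgainDyatlov2018, Theorem 4] is proved in the tree (`bourgainDyatlov2018_thm4_holds`,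
`FractalUncertaintyPrincipleThm4.lean`), DISCHARGES the fact:

  `dyatlovJinNonnenmacher2021_prop_2_9_holds : dyatlovJinNonnenmacher2021_prop_2_9`.

Step 4 of the printed proof [DyatlovJinNonnenmacher2021, §2.4, proof of Prop. 2.9] — the bound
for one pair of unit windows — is `porousFUP_window_of_bd18` (`PorousFractalUncertaintyProofs.lean`).
Here, following the printed Steps 1–3 and 5:

* Steps 1–2 (smooth cutoffs `χ_±` adapted to `Ω_±` at scale `h`, split into unit blocks
  `χ_j^±`): `SmoothGridCutoff.lean` (`blockFun`), at scale `ε = νh/6` so that the supports lie in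
  the `νh/3`-neighbourhoods `Ω_±(νh/3)`, which are `ν/3`-porous on scales `h` to `1` by DJN
  Lemma 2.11 (`IsPorousOnScales.thickening`);
* the pieces `A_{jk} = χ_j^- 𝓕_h χ_k^+` as integral operators on `L²(ℝ)` with the continuous
  compactly supported kernels `(2πh)^{-1/2} χ_j^-(ξ) e^{-ixξ/h} χ_k^+(x)` (`productKernel`,
  `djnKernel`; `L2KernelOperator.lean`), the bound (2.38) `‖A_{jk}‖ ≤ C h^β` from Step 4
  (`norm_djnOp_le`), and the bounds (2.39)–(2.40)
  `‖A_{jk}A_{j'k'}^*‖, ‖A_{j'k'}^*A_{jk}‖ ≤ C_N h^{-1} (1+|j-j'|+|k-k'|)^{-N}` of Step 5 by `N`-fold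
  integration by parts (`pow_mul_norm_fourier_blockFun_mul_le`) and the vanishing
  `A_{jk}A_{j'k'}^* = 0` for `|k-k'| > 1` (`norm_djnOp_mul_star_le_zero/decay`,
  `norm_star_djnOp_mul_le_zero/decay`);
* Step 3: the Cotlar–Stein sums (2.41)–(2.42), `sup ∑ ‖A A'^*‖^{1/2} ≤ C h^{β/2}`, splitting at
  `|j-j'| = R₀ = ⌈h^{-β/2}⌉ + 2` with `N = 2(⌈1/β⌉ + 3)` integrations by parts (weights
  `djnWeightA/B`, `sum_djnWeightA_le`, `djn_rowSum_le`), and the Cotlar–Stein lemma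
  (`CotlarStein.lean`) for the finite family indexed by the blocks meeting bounded `Ω_±`
  (`norm_sum_djnOp_le`); the bounded case is `fup_bounded_of_window`;
* the passage from bounded to unbounded `Ω_±` by monotone convergence in `Ω₋ ∩ [-R, R]` and
  `L¹`-truncation of `u` (the constants do not depend on `R`).

## References

* [DyatlovJinNonnenmacher2021] S. Dyatlov, L. Jin, S. Nonnenmacher, *Control of eigenfunctions on
  surfaces of variable curvature*, J. Amer. Math. Soc. 35 (2022), 361–465 = arXiv:1906.08923,
  §2.4, Prop. 2.9 and its proof, Steps 1–5, (2.33)–(2.42); Lemma 2.11.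
* [BourgainDyatlov2018] J. Bourgain, S. Dyatlov, Ann. of Math. 187 (2018), Theorem 4.
* [GrafakosMFA2014] L. Grafakos, *Modern Fourier Analysis*, 3rd ed., Lemma 4.5.1 (Cotlar–Stein).
-/

noncomputable section

open MeasureTheory Set Filter
open scoped FourierTransform ComplexConjugate InnerProductSpace ENNReal Real Topology

namespace Literature.Analysis.Fourier

open Literature.Analysis.OperatorTheory

/-! ## Product kernels `c_h φ(ξ) e^{σ i x ξ / h} ψ(x)` -/

/-- The semiclassical constant `c_h = (2πh)^{-1/2}` (as a complex number). [cite: DyatlovJinNonnenmacher2021, §2.4 (2.32)] -/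
def shConst (h : ℝ) : ℂ := (((2 * π * h) ^ (-(1 / 2 : ℝ)) : ℝ) : ℂ)

/-- `c_h` is real. [folklore] -/
theorem conj_shConst (h : ℝ) : conj (shConst h) = shConst h := Complex.conj_ofReal _

/-- `|c_h|² = (2πh)⁻¹`. [folklore] -/
theorem norm_shConst_sq {h : ℝ} (hh : 0 < h) : ‖shConst h‖ ^ 2 = (2 * π * h)⁻¹ := by
  have h2 : 0 < 2 * π * h := by positivity
  rw [shConst, Complex.norm_real, Real.norm_of_nonneg (Real.rpow_nonneg h2.le _), ← Real.rpow_natCast,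
    ← Real.rpow_mul h2.le, show (-(1 / 2 : ℝ)) * ((2 : ℕ) : ℝ) = -1 by norm_num, Real.rpow_neg_one]

/-- The kernel `c_h φ(ξ) e^{σ i x ξ/h} ψ(x)` (`σ = -1`: the kernel of `φ 𝓕_h ψ`; `σ = +1`: of its
adjoint `\bar ψ 𝓕_h^* \bar φ`). [cite: DyatlovJinNonnenmacher2021, §2.4, proof of Prop. 2.9, Steps 2 and 5] -/
def productKernel (h σ : ℝ) (φ ψ : ℝ → ℂ) (ξ x : ℝ) : ℂ :=
  shConst h * (φ ξ * Complex.exp ((σ : ℂ) * Complex.I * x * ξ / h) * ψ x)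

/-- A product kernel with continuous factors vanishing off compact intervals is nice. [folklore] -/
theorem niceKernel_productKernel (h σ : ℝ) {φ ψ : ℝ → ℂ} (hφ : Continuous φ) (hψ : Continuous ψ)
    {a b c d : ℝ} (hφ0 : ∀ ξ, ξ ∉ Icc a b → φ ξ = 0) (hψ0 : ∀ x, x ∉ Icc c d → ψ x = 0) :
    NiceKernel (productKernel h σ φ ψ) where
  continuous := by
    show Continuous fun p : ℝ × ℝ =>
      shConst h * (φ p.1 * Complex.exp ((σ : ℂ) * Complex.I * p.2 * p.1 / h) * ψ p.2)
    fun_prop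
  hasCompactSupport := by
    refine HasCompactSupport.of_support_subset_isCompact (isCompact_Icc.prod isCompact_Icc)
      (K := Icc a b ×ˢ Icc c d) fun p hp => ?_
    rw [Function.mem_support] at hp
    refine ⟨?_, ?_⟩
    · by_contra hc
      exact hp (by simp [Function.uncurry, productKernel, hφ0 p.1 hc])
    · by_contra hc
      exact hp (by simp [Function.uncurry, productKernel, hψ0 p.2 hc])

/-- The product kernel vanishes where `φ` does. [folklore] -/
theorem productKernel_eq_zero_left {h σ : ℝ} {φ ψ : ℝ → ℂ} {ξ : ℝ} (hφ : φ ξ = 0) (x : ℝ) :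
    productKernel h σ φ ψ ξ x = 0 := by simp [productKernel, hφ]

/-- The product kernel vanishes where `ψ` does. [folklore] -/
theorem productKernel_eq_zero_right {h σ : ℝ} {φ ψ : ℝ → ℂ} (ξ : ℝ) {x : ℝ} (hψ : ψ x = 0) :
    productKernel h σ φ ψ ξ x = 0 := by simp [productKernel, hψ]

/-- The adjoint kernel of a product kernel is the product kernel with `σ ↦ -σ` and the conjugated
factors swapped. [folklore] -/
theorem adjointKernel_productKernel (h σ : ℝ) (φ ψ : ℝ → ℂ) :
    adjointKernel (productKernel h σ φ ψ) =
      productKernel h (-σ) (fun x => conj (ψ x)) (fun ξ => conj (φ ξ)) := by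
  funext a b
  simp only [adjointKernel, productKernel, map_mul, conj_shConst, ← Complex.exp_conj, map_div₀,
    Complex.conj_ofReal, Complex.conj_I]
  congr 1
  rw [show (↑(-σ) : ℂ) = -(σ : ℂ) by push_cast; ring]
  ring_nf

/-- **The kernel of `T_{K₁}^* T_{K₂}` for two product kernels with the same `σ`:**
`N(x, y) = c_h² conj ψ₁(x) ψ₂(y) · 𝓕(conj φ₁ · φ₂)(σ (x - y)/(2πh))`. [cite: DyatlovJinNonnenmacher2021, §2.4, proof of Prop. 2.9, Step 5 ("the integral kernel … can be computed in terms of the Fourier transform of χ_k^+ χ_{k'}^+")] -/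
theorem grammKernel_productKernel {h : ℝ} (hh : h ≠ 0) (σ : ℝ) (φ₁ ψ₁ φ₂ ψ₂ : ℝ → ℂ) (x y : ℝ) :
    grammKernel (productKernel h σ φ₁ ψ₁) (productKernel h σ φ₂ ψ₂) x y =
      shConst h ^ 2 * (conj (ψ₁ x) * ψ₂ y) *
        𝓕 (fun ξ => conj (φ₁ ξ) * φ₂ ξ) (σ * (x - y) / (2 * π * h)) := by
  rw [grammKernel, Real.fourier_real_eq_integral_exp_smul, ← integral_const_mul]
  refine integral_congr_ae (Eventually.of_forall fun ξ => ?_)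
  simp only [productKernel, map_mul, conj_shConst, ← Complex.exp_conj, map_div₀, Complex.conj_ofReal,
    Complex.conj_I, smul_eq_mul]
  have hexp : Complex.exp (↑σ * -Complex.I * ↑x * ↑ξ / ↑h) *
      Complex.exp (↑σ * Complex.I * ↑y * ↑ξ / ↑h) =
        Complex.exp (↑(-2 * π * ξ * (σ * (x - y) / (2 * π * h))) * Complex.I) := by
    rw [← Complex.exp_add]
    congr 1
    have hπ : (π : ℂ) ≠ 0 := Complex.ofReal_ne_zero.2 Real.pi_pos.ne'
    have hh' : (h : ℂ) ≠ 0 := Complex.ofReal_ne_zero.2 hh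
    push_cast
    field_simp
    ring
  calc shConst h * ((starRingEnd ℂ) (φ₁ ξ) *
        Complex.exp (↑σ * -Complex.I * ↑x * ↑ξ / ↑h) * (starRingEnd ℂ) (ψ₁ x)) *
        (shConst h * (φ₂ ξ * Complex.exp (↑σ * Complex.I * ↑y * ↑ξ / ↑h) * ψ₂ y))
      = shConst h ^ 2 * ((starRingEnd ℂ) (ψ₁ x) * ψ₂ y) *
          ((Complex.exp (↑σ * -Complex.I * ↑x * ↑ξ / ↑h) *
            Complex.exp (↑σ * Complex.I * ↑y * ↑ξ / ↑h)) * ((starRingEnd ℂ) (φ₁ ξ) * φ₂ ξ)) := by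
        ring
    _ = _ := by rw [hexp]

/-- `|N(x, y)| ≤ (2πh)^{-1} |ψ₁(x)| |ψ₂(y)| |𝓕(conj φ₁ φ₂)(σ(x-y)/(2πh))|`. [folklore] -/
theorem norm_grammKernel_productKernel_le {h : ℝ} (hh : 0 < h) (σ : ℝ) (φ₁ ψ₁ φ₂ ψ₂ : ℝ → ℂ)
    (x y : ℝ) :
    ‖grammKernel (productKernel h σ φ₁ ψ₁) (productKernel h σ φ₂ ψ₂) x y‖ ≤
      (2 * π * h)⁻¹ * (‖ψ₁ x‖ * ‖ψ₂ y‖) *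
        ‖𝓕 (fun ξ => conj (φ₁ ξ) * φ₂ ξ) (σ * (x - y) / (2 * π * h))‖ := by
  rw [grammKernel_productKernel hh.ne', norm_mul, norm_mul, norm_pow, norm_shConst_sq hh, norm_mul,
    Complex.norm_conj]

/-! ## The pieces `A_{jk} = χ_j^- 𝓕_h χ_k^+` -/

/-- The kernel `(2πh)^{-1/2} χ_j^-(ξ) e^{-ixξ/h} χ_k^+(x)` of `A_{jk} = χ_j^- 𝓕_h χ_k^+`, with
`χ_j^- = blockFun X ε M j` (frequency side, `Ω₋ = X`) and `χ_k^+ = blockFun Y ε M k` (position side,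
`Ω₊ = Y`). [cite: DyatlovJinNonnenmacher2021, §2.4, proof of Prop. 2.9, Step 2 ("A_{jk} := χ_j^- 𝓕_h χ_k^+")] -/
def djnKernel (h ε : ℝ) (M : ℕ) (X Y : Set ℝ) (j k : ℤ) : ℝ → ℝ → ℂ :=
  productKernel h (-1) (blockFun X ε M j) (blockFun Y ε M k)

/-- The kernel of `A_{jk}` is nice (`ε > 0`). [folklore] -/
theorem niceKernel_djnKernel (h : ℝ) {ε : ℝ} (hε : 0 < ε) (M : ℕ) (X Y : Set ℝ) (j k : ℤ) :
    NiceKernel (djnKernel h ε M X Y j k) :=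
  niceKernel_productKernel h (-1) (continuous_blockFun X ε M j) (continuous_blockFun Y ε M k)
    (a := (j : ℝ) - ε) (b := j + 1 + ε) (c := (k : ℝ) - ε) (d := k + 1 + ε)
    (fun ξ hξ => by by_contra hne; exact hξ (mem_of_blockFun_ne_zero hε hne).1)
    (fun x hx => by by_contra hne; exact hx (mem_of_blockFun_ne_zero hε hne).1)

/-- **`A_{jk} u = χ_j^- · 𝓕_h(χ_k^+ u)`:** the integral operator with kernel `djnKernel` acts as
printed. [cite: DyatlovJinNonnenmacher2021, §2.4, proof of Prop. 2.9, Step 2] -/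
theorem kernelFun_djnKernel (h ε : ℝ) (M : ℕ) (X Y : Set ℝ) (j k : ℤ) (u : ℝ → ℂ) (ξ : ℝ) :
    kernelFun (djnKernel h ε M X Y j k) u ξ =
      blockFun X ε M j ξ * fourierSemiclassical h (fun x => blockFun Y ε M k x * u x) ξ := by
  rw [kernelFun, fourierSemiclassical, ← mul_assoc, ← integral_const_mul]
  refine integral_congr_ae (Eventually.of_forall fun x => ?_)
  simp only [djnKernel, productKernel, shConst]
  have : Complex.exp (↑(-1 : ℝ) * Complex.I * ↑x * ↑ξ / ↑h) =
      Complex.exp (-(Complex.I * ↑x * ↑ξ / ↑h)) := by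
    congr 1; push_cast; ring
  rw [this]
  ring

/-- The operator `A_{jk}` on `L²(ℝ)`. [cite: DyatlovJinNonnenmacher2021, §2.4, proof of Prop. 2.9, Step 2] -/
def djnOp (h : ℝ) {ε : ℝ} (hε : 0 < ε) (M : ℕ) (X Y : Set ℝ) (j k : ℤ) :
    Lp ℂ 2 (volume : Measure ℝ) →L[ℂ] Lp ℂ 2 (volume : Measure ℝ) :=
  kernelOp (niceKernel_djnKernel h hε M X Y j k)

/-- Unfolding `djnOp`. [folklore] -/
theorem djnOp_eq (h : ℝ) {ε : ℝ} (hε : 0 < ε) (M : ℕ) (X Y : Set ℝ) (j k : ℤ) :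
    djnOp h hε M X Y j k = kernelOp (niceKernel_djnKernel h hε M X Y j k) := rfl

/-! ## Step 4 input: `‖A_{jk}‖ ≤ C h^β` -/

section Pieces

variable {ν β C h ε : ℝ} {M : ℕ} {X Y : Set ℝ}

/-- The `2ε = νh/3`-neighbourhood of a set `ν`-porous on scales `h` to `1` is `ν/3`-porous on
scales `h` to `1` (DJN Lemma 2.11 with `α₂ = νh/3`). [cite: DyatlovJinNonnenmacher2021, Lemma 2.11 and proof of Prop. 2.9, Step 4] -/
theorem porous_thickening_of_eq (hν : 0 < ν) (hε : ε = ν * h / 6) (hXp : IsPorousOnScales X ν h 1) :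
    IsPorousOnScales {x : ℝ | ∃ y ∈ X, |x - y| ≤ 2 * ε} (ν / 3) h 1 := by
  have hth := hXp.thickening (α₂ := 2 * ε) hν
  have hmax : max h (3 / ν * (2 * ε)) = h := by
    rw [hε, max_eq_left (le_of_eq _)]
    field_simp
    ring
  rwa [hmax] at hth

/-- **(2.38) for the smooth pieces:** `∫ |χ_j^-(ξ)|² |𝓕_h(χ_k^+ u)(ξ)|² dξ ≤ (C h^β)² ∫ |u|²` for
`u ∈ L¹ ∩ L²`, from the window bound for `ν/3`-porous sets (`porousFUP_window_of_bd18`) applied to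
`supp χ_j^- ⊆ Ω₋(νh/3) ∩ [j-ε, j+1+ε]`, `supp χ_k^+ ⊆ Ω₊(νh/3) ∩ [k-ε, k+1+ε]`. [cite: DyatlovJinNonnenmacher2021, §2.4, proof of Prop. 2.9, Step 4, (2.38) and (2.41)] -/
theorem integral_norm_sq_piece_le (hν : 0 < ν)
    (HW : ∀ h : ℝ, 0 < h → h ≤ 1 → ∀ j k : ℝ, ∀ X Y : Set ℝ,
      X ⊆ Icc (j - 1) (j + 1) → Y ⊆ Icc (k - 1) (k + 1) →
        IsPorousOnScales X (ν / 3) h 1 → IsPorousOnScales Y (ν / 3) h 1 →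
          ∀ u : ℝ → ℂ, Integrable u → MemLp u 2 volume → (∀ x, x ∉ Y → u x = 0) →
            ∫ ξ in X, ‖fourierSemiclassical h u ξ‖ ^ 2 ≤ (C * h ^ β) ^ 2 * ∫ x, ‖u x‖ ^ 2)
    (hh : 0 < h) (hh1 : h ≤ 1) (hε : ε = ν * h / 6) (hν1 : ν < 1)
    (hXp : IsPorousOnScales X ν h 1) (hYp : IsPorousOnScales Y ν h 1) (j k : ℤ)
    {u : ℝ → ℂ} (hu1 : Integrable u) (hu2 : MemLp u 2 volume) :
    ∫ ξ, ‖blockFun X ε M j ξ * fourierSemiclassical h (fun x => blockFun Y ε M k x * u x) ξ‖ ^ 2 ≤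
      (C * h ^ β) ^ 2 * ∫ x, ‖u x‖ ^ 2 := by
  have hε0 : 0 < ε := by rw [hε]; positivity
  have hε2 : ε ≤ 1 / 2 := by rw [hε]; nlinarith
  -- the windows
  set X' : Set ℝ := Icc ((j : ℝ) - ε) (j + 1 + ε) ∩ {x : ℝ | ∃ y ∈ X, |x - y| ≤ 2 * ε} with hX'
  set Y' : Set ℝ := Icc ((k : ℝ) - ε) (k + 1 + ε) ∩ {x : ℝ | ∃ y ∈ Y, |x - y| ≤ 2 * ε} with hY'
  have hX'sub : X' ⊆ Icc (((j : ℝ) + 1 / 2) - 1) (((j : ℝ) + 1 / 2) + 1) := by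
    rintro ξ ⟨⟨h1, h2⟩, -⟩; constructor <;> linarith
  have hY'sub : Y' ⊆ Icc (((k : ℝ) + 1 / 2) - 1) (((k : ℝ) + 1 / 2) + 1) := by
    rintro x ⟨⟨h1, h2⟩, -⟩; constructor <;> linarith
  have hX'p : IsPorousOnScales X' (ν / 3) h 1 :=
    (porous_thickening_of_eq hν hε hXp).mono inter_subset_right
  have hY'p : IsPorousOnScales Y' (ν / 3) h 1 :=
    (porous_thickening_of_eq hν hε hYp).mono inter_subset_right
  -- the function `χ_k^+ u`
  set w : ℝ → ℂ := fun x => blockFun Y ε M k x * u x with hw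
  have hwm : AEStronglyMeasurable w volume :=
    (continuous_blockFun Y ε M k).aestronglyMeasurable.mul hu1.aestronglyMeasurable
  have hwle : ∀ x, ‖w x‖ ≤ ‖u x‖ := fun x => by
    rw [hw, norm_mul]
    exact mul_le_of_le_one_left (norm_nonneg _) (norm_blockFun_le_one Y ε M k x)
  have hw1 : Integrable w :=
    hu1.bdd_mul (c := 1) (continuous_blockFun Y ε M k).aestronglyMeasurable
      (Eventually.of_forall fun x => norm_blockFun_le_one Y ε M k x)
  have hw2 : MemLp w 2 volume := hu2.of_le hwm (Eventually.of_forall hwle)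
  have hw0 : ∀ x, x ∉ Y' → w x = 0 := by
    intro x hx
    have : blockFun Y ε M k x = 0 := by
      by_contra hne
      exact hx ⟨(mem_of_blockFun_ne_zero hε0 hne).1, (mem_of_blockFun_ne_zero hε0 hne).2⟩
    simp [hw, this]
  have key := HW h hh hh1 ((j : ℝ) + 1 / 2) ((k : ℝ) + 1 / 2) X' Y' hX'sub hY'sub hX'p hY'p w hw1 hw2 hw0
  -- compare the left-hand sides
  set F : ℝ → ℂ := fourierSemiclassical h w with hF
  have hFc : Continuous F := continuous_fourierSemiclassical hh hw1
  have hzero : ∀ ξ, ξ ∉ X' → ‖blockFun X ε M j ξ * F ξ‖ ^ 2 = 0 := by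
    intro ξ hξ
    have : blockFun X ε M j ξ = 0 := by
      by_contra hne
      exact hξ ⟨(mem_of_blockFun_ne_zero hε0 hne).1, (mem_of_blockFun_ne_zero hε0 hne).2⟩
    simp [this]
  have hwint : ∫ x, ‖w x‖ ^ 2 ≤ ∫ x, ‖u x‖ ^ 2 :=
    integral_mono_of_nonneg (Eventually.of_forall fun _ => by positivity)
      ((memLp_two_iff_integrable_sq_norm hu2.aestronglyMeasurable).1 hu2)
      (Eventually.of_forall fun x => pow_le_pow_left₀ (norm_nonneg _) (hwle x) 2)
  calc ∫ ξ, ‖blockFun X ε M j ξ * F ξ‖ ^ 2 = ∫ ξ in X', ‖blockFun X ε M j ξ * F ξ‖ ^ 2 :=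
        (setIntegral_eq_integral_of_forall_compl_eq_zero fun ξ hξ => hzero ξ hξ).symm
    _ ≤ ∫ ξ in X', ‖F ξ‖ ^ 2 := by
        refine setIntegral_mono ?_ ?_ fun ξ => ?_
        · exact (((continuous_blockFun X ε M j).mul hFc).norm.pow 2).integrableOn_Icc.mono_set
            (hX'sub)
        · exact ((hFc.norm).pow 2).integrableOn_Icc.mono_set hX'sub
        · rw [norm_mul, mul_pow]
          exact mul_le_of_le_one_left (by positivity)
            (pow_le_one₀ (norm_nonneg _) (norm_blockFun_le_one X ε M j ξ))
    _ ≤ (C * h ^ β) ^ 2 * ∫ x, ‖w x‖ ^ 2 := key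
    _ ≤ (C * h ^ β) ^ 2 * ∫ x, ‖u x‖ ^ 2 := mul_le_mul_of_nonneg_left hwint (sq_nonneg _)

/-- **(2.38): `‖A_{jk}‖ ≤ C h^β`.** [cite: DyatlovJinNonnenmacher2021, §2.4, proof of Prop. 2.9, Steps 3–4, (2.38)] -/
theorem norm_djnOp_le (hν : 0 < ν)
    (HW : ∀ h : ℝ, 0 < h → h ≤ 1 → ∀ j k : ℝ, ∀ X Y : Set ℝ,
      X ⊆ Icc (j - 1) (j + 1) → Y ⊆ Icc (k - 1) (k + 1) →
        IsPorousOnScales X (ν / 3) h 1 → IsPorousOnScales Y (ν / 3) h 1 →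
          ∀ u : ℝ → ℂ, Integrable u → MemLp u 2 volume → (∀ x, x ∉ Y → u x = 0) →
            ∫ ξ in X, ‖fourierSemiclassical h u ξ‖ ^ 2 ≤ (C * h ^ β) ^ 2 * ∫ x, ‖u x‖ ^ 2)
    (hC : 0 ≤ C) (hh : 0 < h) (hh1 : h ≤ 1) (hε : ε = ν * h / 6) (hε0 : 0 < ε) (hν1 : ν < 1)
    (hXp : IsPorousOnScales X ν h 1) (hYp : IsPorousOnScales Y ν h 1) (j k : ℤ) :
    ‖djnOp h hε0 M X Y j k‖ ≤ C * h ^ β := by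
  have hCh : 0 ≤ C * h ^ β := mul_nonneg hC (Real.rpow_nonneg hh.le _)
  refine ContinuousLinearMap.opNorm_le_bound _ hCh fun u => ?_
  have hu2 : MemLp (u : ℝ → ℂ) 2 volume := Lp.memLp u
  -- `u ∈ L²`; its restriction to the window `[k-ε, k+1+ε]` is in `L¹ ∩ L²` and `χ_k^+ u` only sees it
  set u' : ℝ → ℂ := (Icc ((k : ℝ) - ε) (k + 1 + ε)).indicator (u : ℝ → ℂ) with hu'
  have hu'1 : Integrable u' := (integrableOn_Icc_of_memLp hu2 _ _).integrable_indicator measurableSet_Icc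
  have hu'2 : MemLp u' 2 volume := hu2.indicator measurableSet_Icc
  have hprod : ∀ x, blockFun Y ε M k x * (u : ℝ → ℂ) x = blockFun Y ε M k x * u' x := by
    intro x
    by_cases hx : x ∈ Icc ((k : ℝ) - ε) (k + 1 + ε)
    · rw [hu', indicator_of_mem hx]
    · have : blockFun Y ε M k x = 0 := by
        by_contra hne; exact hx (mem_of_blockFun_ne_zero hε0 hne).1
      rw [this, zero_mul, zero_mul]
  have hsq : ‖djnOp h hε0 M X Y j k u‖ ^ 2 ≤ (C * h ^ β * ‖u‖) ^ 2 := by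
    rw [djnOp_eq, norm_kernelOp_sq]
    simp_rw [kernelFun_djnKernel, hprod]
    refine (integral_norm_sq_piece_le hν HW hh hh1 hε hν1 hXp hYp j k hu'1 hu'2 (M := M)).trans ?_
    rw [show (C * h ^ β * ‖u‖) ^ 2 = (C * h ^ β) ^ 2 * ‖u‖ ^ 2 by ring, norm_Lp_sq_eq_integral]
    refine mul_le_mul_of_nonneg_left ?_ (sq_nonneg _)
    refine integral_mono_of_nonneg (Eventually.of_forall fun _ => by positivity)
      ((memLp_two_iff_integrable_sq_norm hu2.aestronglyMeasurable).1 hu2)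
      (Eventually.of_forall fun x => ?_)
    rw [hu']
    exact pow_le_pow_left₀ (norm_nonneg _) (norm_indicator_le_norm_self _ _) 2
  exact le_of_pow_le_pow_left₀ two_ne_zero (mul_nonneg hCh (norm_nonneg _)) hsq

end Pieces

/-! ## Step 5: almost orthogonality of the pieces -/

section AlmostOrthogonal

variable {h ε : ℝ} {M : ℕ}

/-- Integral operators with equal kernels are equal. [folklore] -/
theorem kernelOp_congr {K₁ K₂ : ℝ → ℝ → ℂ} (h₁ : NiceKernel K₁) (h₂ : NiceKernel K₂) (e : K₁ = K₂) :
    kernelOp h₁ = kernelOp h₂ := by subst e; rfl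

/-- The adjoint kernel of `A_{jk}`: `(2πh)^{-1/2} χ_k^+(x) e^{+ixξ/h} χ_j^-(ξ)` (the blocks are
real). [cite: DyatlovJinNonnenmacher2021, §2.4, proof of Prop. 2.9, Step 5 ("A_{jk}A_{j'k'}^* = χ_j^- 𝓕_h χ_k^+ χ_{k'}^+ 𝓕_h^* χ_{j'}^-")] -/
theorem adjointKernel_djnKernel (h ε : ℝ) (M : ℕ) (X Y : Set ℝ) (j k : ℤ) :
    adjointKernel (djnKernel h ε M X Y j k) = productKernel h 1 (blockFun Y ε M k) (blockFun X ε M j) := by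
  rw [djnKernel, adjointKernel_productKernel]
  simp only [conj_blockFun, neg_neg]

/-- Product kernels of two blocks are nice. [folklore] -/
theorem niceKernel_productKernel_blockFun (h σ : ℝ) {ε : ℝ} (hε : 0 < ε) (M : ℕ) (S₁ S₂ : Set ℝ)
    (m n : ℤ) : NiceKernel (productKernel h σ (blockFun S₁ ε M m) (blockFun S₂ ε M n)) :=
  niceKernel_productKernel h σ (continuous_blockFun S₁ ε M m) (continuous_blockFun S₂ ε M n)
    (a := (m : ℝ) - ε) (b := m + 1 + ε) (c := (n : ℝ) - ε) (d := n + 1 + ε)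
    (fun ξ hξ => by by_contra hne; exact hξ (mem_of_blockFun_ne_zero hε hne).1)
    (fun x hx => by by_contra hne; exact hx (mem_of_blockFun_ne_zero hε hne).1)

/-- **The Schur bound for two product kernels of blocks** from a bound `D` on
`|𝓕(χ_{m₁} χ_{m₂})(σ(x-y)/(2πh))|` over the `x`-windows: `|⟪T₁ u, T₂ v⟫| ≤ 2 (2πh)⁻¹ D ‖u‖ ‖v‖`
(the kernel `𝒦` of `T₂^* T₁` is bounded by `(2πh)⁻¹ D` and supported in a square of side
`1 + 2ε ≤ 2`). [cite: DyatlovJinNonnenmacher2021, §2.4, proof of Prop. 2.9, Step 5 ("Since 𝒦(x,y) is supported in a square of size 2, this implies (2.39)")] -/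
theorem norm_inner_blockOp_le (hh : 0 < h) (hε : 0 < ε) (hε2 : ε ≤ 1 / 2) (σ : ℝ) {S₁ S₂ S₃ S₄ : Set ℝ}
    {m₁ n₁ m₂ n₂ : ℤ}
    (h₁ : NiceKernel (productKernel h σ (blockFun S₁ ε M m₁) (blockFun S₂ ε M n₁)))
    (h₂ : NiceKernel (productKernel h σ (blockFun S₃ ε M m₂) (blockFun S₄ ε M n₂)))
    {D : ℝ} (hD0 : 0 ≤ D)
    (hD : ∀ x ∈ Icc ((n₁ : ℝ) - ε) (n₁ + 1 + ε), ∀ y ∈ Icc ((n₂ : ℝ) - ε) (n₂ + 1 + ε),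
      ‖𝓕 (fun ξ => blockFun S₁ ε M m₁ ξ * blockFun S₃ ε M m₂ ξ) (σ * (x - y) / (2 * π * h))‖ ≤ D)
    (u v : Lp ℂ 2 (volume : Measure ℝ)) :
    ‖⟪kernelOp h₁ u, kernelOp h₂ v⟫_ℂ‖ ≤ 2 * ((2 * π * h)⁻¹ * D) * ‖u‖ * ‖v‖ := by
  have h2πh : 0 < (2 * π * h)⁻¹ := by positivity
  have key := norm_inner_kernelOp_kernelOp_le h₁ h₂ (a₁ := (n₁ : ℝ) - ε) (b₁ := n₁ + 1 + ε)
    (a₂ := (n₂ : ℝ) - ε) (b₂ := n₂ + 1 + ε) (by linarith) (by linarith)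
    (fun ξ x hne => by
      by_contra hx
      refine hne (productKernel_eq_zero_right ξ ?_)
      by_contra hb; exact hx (mem_of_blockFun_ne_zero hε hb).1)
    (fun ξ y hne => by
      by_contra hy
      refine hne (productKernel_eq_zero_right ξ ?_)
      by_contra hb; exact hy (mem_of_blockFun_ne_zero hε hb).1)
    (D := (2 * π * h)⁻¹ * D) (by positivity)
    (fun x hx y hy => by
      refine (norm_grammKernel_productKernel_le hh σ _ _ _ _ x y).trans ?_
      simp only [conj_blockFun]
      have hψ : ‖blockFun S₂ ε M n₁ x‖ * ‖blockFun S₄ ε M n₂ y‖ ≤ 1 :=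
        mul_le_one₀ (norm_blockFun_le_one _ _ _ _ _) (norm_nonneg _) (norm_blockFun_le_one _ _ _ _ _)
      calc (2 * π * h)⁻¹ * (‖blockFun S₂ ε M n₁ x‖ * ‖blockFun S₄ ε M n₂ y‖) *
            ‖𝓕 (fun ξ => blockFun S₁ ε M m₁ ξ * blockFun S₃ ε M m₂ ξ) (σ * (x - y) / (2 * π * h))‖
          ≤ (2 * π * h)⁻¹ * 1 * D := by
            refine mul_le_mul (mul_le_mul_of_nonneg_left hψ h2πh.le) (hD x hx y hy) (norm_nonneg _) ?_
            positivity
        _ = (2 * π * h)⁻¹ * D := by ring)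
    u v
  have hsqrt : Real.sqrt (↑n₁ + 1 + ε - (↑n₁ - ε)) * Real.sqrt (↑n₂ + 1 + ε - (↑n₂ - ε)) = 1 + 2 * ε := by
    rw [show (n₁ : ℝ) + 1 + ε - (↑n₁ - ε) = 1 + 2 * ε by ring,
      show (n₂ : ℝ) + 1 + ε - (↑n₂ - ε) = 1 + 2 * ε by ring, Real.mul_self_sqrt (by linarith)]
  calc ‖⟪kernelOp h₁ u, kernelOp h₂ v⟫_ℂ‖
      ≤ (2 * π * h)⁻¹ * D * Real.sqrt (↑n₁ + 1 + ε - (↑n₁ - ε)) *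
          Real.sqrt (↑n₂ + 1 + ε - (↑n₂ - ε)) * ‖u‖ * ‖v‖ := key
    _ = (1 + 2 * ε) * ((2 * π * h)⁻¹ * D) * ‖u‖ * ‖v‖ := by rw [mul_assoc ((2 * π * h)⁻¹ * D), hsqrt]; ring
    _ ≤ 2 * ((2 * π * h)⁻¹ * D) * ‖u‖ * ‖v‖ := by gcongr; linarith

/-- **Vanishing regime:** if `|m₁ - m₂| ≥ 2` then `χ_{m₁} χ_{m₂} = 0`, so `T₂^* T₁ = 0`:
`⟪T₁ u, T₂ v⟫ = 0`. [cite: DyatlovJinNonnenmacher2021, §2.4, proof of Prop. 2.9, Step 5 ("If |k-k'|>1 then supp χ_k^+ ∩ supp χ_{k'}^+ = ∅ and thus A_{jk}A_{j'k'}^* = 0")] -/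
theorem norm_inner_blockOp_le_zero (hh : 0 < h) (hε : 0 < ε) (hε2 : ε < 1 / 2) (σ : ℝ)
    {S₁ S₂ S₃ S₄ : Set ℝ} {m₁ n₁ m₂ n₂ : ℤ} (hm : 2 ≤ |m₁ - m₂|)
    (h₁ : NiceKernel (productKernel h σ (blockFun S₁ ε M m₁) (blockFun S₂ ε M n₁)))
    (h₂ : NiceKernel (productKernel h σ (blockFun S₃ ε M m₂) (blockFun S₄ ε M n₂)))
    (u v : Lp ℂ 2 (volume : Measure ℝ)) :
    ‖⟪kernelOp h₁ u, kernelOp h₂ v⟫_ℂ‖ ≤ 0 * ‖u‖ * ‖v‖ := by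
  have hzero : (fun ξ => blockFun S₁ ε M m₁ ξ * blockFun S₃ ε M m₂ ξ) = fun _ => (0 : ℂ) :=
    funext fun ξ => blockFun_mul_blockFun_eq_zero hε hε2 hm ξ
  have h := norm_inner_blockOp_le (M := M) hh hε hε2.le σ h₁ h₂ (D := 0) le_rfl
    (fun x _ y _ => by rw [hzero]; simp [Real.fourier_real_eq]) u v
  simpa using h

/-- **Decay regime (N-fold integration by parts):** for `|n₁ - n₂| ≥ 3` the points `x, y` of the two
`x`-windows satisfy `|x - y| ≥ |n₁ - n₂|/3`, and `|𝓕(χ_{m₁}χ_{m₂})((x-y)/(2πh))| ≤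
2 E_N ε^{-N} (h/|x-y|)^N ≤ 2 E_N (18/ν)^N |n₁ - n₂|^{-N}` when `ε = νh/6`; hence
`|⟪T₁ u, T₂ v⟫| ≤ (πh)⁻¹ · 2 E_N (18/ν)^N |n₁-n₂|^{-N} ‖u‖ ‖v‖`. [cite: DyatlovJinNonnenmacher2021, §2.4, proof of Prop. 2.9, Step 5, (2.39)–(2.40) ("Integrating by parts N times in ξ, we get sup|𝒦| ≤ C_N h^{-1}|j-j'|^{-N}")] -/
theorem norm_inner_blockOp_le_decay {ν : ℝ} (hν : 0 < ν) (hh : 0 < h) (hh1 : h ≤ 1) (hν1 : ν < 1)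
    (hεd : ε = ν * h / 6) {σ : ℝ} (hσ : |σ| = 1) {S₁ S₂ S₃ S₄ : Set ℝ} {m₁ n₁ m₂ n₂ : ℤ}
    (hn : 3 ≤ |n₁ - n₂|) (N : ℕ)
    (h₁ : NiceKernel (productKernel h σ (blockFun S₁ ε M m₁) (blockFun S₂ ε M n₁)))
    (h₂ : NiceKernel (productKernel h σ (blockFun S₃ ε M m₂) (blockFun S₄ ε M n₂)))
    (u v : Lp ℂ 2 (volume : Measure ℝ)) :
    ‖⟪kernelOp h₁ u, kernelOp h₂ v⟫_ℂ‖ ≤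
      2 * ((2 * π * h)⁻¹ * (2 * blockProdDerivConst N * (18 / ν) ^ N / (|((n₁ - n₂ : ℤ) : ℝ)|) ^ N)) *
        ‖u‖ * ‖v‖ := by
  have hε : 0 < ε := by rw [hεd]; positivity
  have hε2 : ε ≤ 1 / 2 := by rw [hεd]; nlinarith
  have hn' : (3 : ℝ) ≤ |((n₁ - n₂ : ℤ) : ℝ)| := by exact_mod_cast hn
  have hnpos : 0 < |((n₁ - n₂ : ℤ) : ℝ)| := by linarith
  have hE := blockProdDerivConst_nonneg N
  refine norm_inner_blockOp_le (M := M) hh hε hε2 σ h₁ h₂ (by positivity) (fun x hx y hy => ?_) u v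
  -- separation of the windows
  have hsep : |((n₁ - n₂ : ℤ) : ℝ)| / 3 ≤ |x - y| := by
    have e : ((n₁ - n₂ : ℤ) : ℝ) = (n₁ : ℝ) - n₂ := by push_cast; ring
    rw [e] at hn' ⊢
    obtain ⟨hx1, hx2⟩ := hx
    obtain ⟨hy1, hy2⟩ := hy
    rcases le_abs.1 hn' with hcase | hcase
    · rw [abs_of_nonneg (by linarith : (0:ℝ) ≤ n₁ - n₂)]
      exact (le_abs_self _).trans' (by linarith)
    · rw [abs_of_nonpos (by linarith : (n₁ : ℝ) - n₂ ≤ 0)]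
      exact (neg_le_abs _).trans' (by linarith)
  have hxy : 0 < |x - y| := lt_of_lt_of_le (by linarith) hsep
  -- the integration by parts bound
  set w : ℝ := σ * (x - y) / (2 * π * h) with hw
  have habsw : 2 * π * |w| = |x - y| / h := by
    rw [hw, abs_div, abs_mul, hσ, one_mul, abs_of_pos (by positivity : 0 < 2 * π * h)]
    field_simp
  have hibp := pow_mul_norm_fourier_blockFun_mul_le (Ω := S₁) (Ω' := S₃) hε hε2 M m₁ m₂ N w
  rw [habsw] at hibp
  have hpos : 0 < (|x - y| / h) ^ N := by positivity
  have hF : ‖𝓕 (fun ξ => blockFun S₁ ε M m₁ ξ * blockFun S₃ ε M m₂ ξ) w‖ ≤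
      2 * (blockProdDerivConst N * ε⁻¹ ^ N) / (|x - y| / h) ^ N := by
    rw [le_div_iff₀ hpos, mul_comm]; exact hibp
  refine hF.trans ?_
  -- compare the constants: `ε⁻¹ h / |x-y| ≤ (6/ν) (3/|n₁-n₂|) = (18/ν)/|n₁-n₂|`
  have hratio : ε⁻¹ / (|x - y| / h) ≤ (18 / ν) / |((n₁ - n₂ : ℤ) : ℝ)| := by
    rw [hεd, div_le_div_iff₀ (by positivity) hnpos]
    have e1 : (ν * h / 6)⁻¹ * |((n₁ - n₂ : ℤ) : ℝ)| = (6 / (ν * h)) * |((n₁ - n₂ : ℤ) : ℝ)| := by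
      rw [inv_div]
    rw [e1]
    have e2 : 18 / ν * (|x - y| / h) = (6 / (ν * h)) * (3 * |x - y|) := by
      field_simp; ring
    rw [e2]
    exact mul_le_mul_of_nonneg_left (by linarith) (by positivity)
  have hratio0 : 0 ≤ ε⁻¹ / (|x - y| / h) := by positivity
  calc 2 * (blockProdDerivConst N * ε⁻¹ ^ N) / (|x - y| / h) ^ N
      = 2 * blockProdDerivConst N * (ε⁻¹ / (|x - y| / h)) ^ N := by
        rw [div_pow]; ring
    _ ≤ 2 * blockProdDerivConst N * ((18 / ν) / |((n₁ - n₂ : ℤ) : ℝ)|) ^ N := by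
        gcongr
    _ = 2 * blockProdDerivConst N * (18 / ν) ^ N / |((n₁ - n₂ : ℤ) : ℝ)| ^ N := by
        rw [div_pow]; ring

/-- `⟪(A_p A_q^*) u, v⟫ = ⟪T₁ u, T₂ v⟫` with `T₁ = A_q^*`, `T₂ = A_p^*` written as product-kernel
operators with `σ = +1`. [folklore] -/
theorem inner_djnOp_mul_star (h : ℝ) (hε : 0 < ε) (M : ℕ) (X Y : Set ℝ) (j k j' k' : ℤ)
    (u v : Lp ℂ 2 (volume : Measure ℝ)) :
    ⟪(djnOp h hε M X Y j k * star (djnOp h hε M X Y j' k')) u, v⟫_ℂ =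
      ⟪kernelOp (niceKernel_productKernel_blockFun h 1 hε M Y X k' j') u,
        kernelOp (niceKernel_productKernel_blockFun h 1 hε M Y X k j) v⟫_ℂ := by
  rw [ContinuousLinearMap.mul_def, ContinuousLinearMap.comp_apply, ContinuousLinearMap.star_eq_adjoint,
    ← ContinuousLinearMap.adjoint_inner_right, djnOp_eq, djnOp_eq, adjoint_kernelOp, adjoint_kernelOp,
    kernelOp_congr (niceKernel_djnKernel h hε M X Y j' k').adjoint
      (niceKernel_productKernel_blockFun h 1 hε M Y X k' j') (adjointKernel_djnKernel h ε M X Y j' k'),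
    kernelOp_congr (niceKernel_djnKernel h hε M X Y j k).adjoint
      (niceKernel_productKernel_blockFun h 1 hε M Y X k j) (adjointKernel_djnKernel h ε M X Y j k)]

/-- `⟪(A_p^* A_q) u, v⟫ = ⟪A_q u, A_p v⟫`. [folklore] -/
theorem inner_star_djnOp_mul (h : ℝ) (hε : 0 < ε) (M : ℕ) (X Y : Set ℝ) (j k j' k' : ℤ)
    (u v : Lp ℂ 2 (volume : Measure ℝ)) :
    ⟪(star (djnOp h hε M X Y j k) * djnOp h hε M X Y j' k') u, v⟫_ℂ =
      ⟪kernelOp (niceKernel_productKernel_blockFun h (-1) hε M X Y j' k') u,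
        kernelOp (niceKernel_productKernel_blockFun h (-1) hε M X Y j k) v⟫_ℂ := by
  rw [ContinuousLinearMap.mul_def, ContinuousLinearMap.comp_apply, ContinuousLinearMap.star_eq_adjoint,
    ContinuousLinearMap.adjoint_inner_left]
  rfl

/-- **(2.39), vanishing part:** `A_{jk} A_{j'k'}^* = 0` if `|k - k'| ≥ 2`. [cite: DyatlovJinNonnenmacher2021, §2.4, proof of Prop. 2.9, Step 5] -/
theorem norm_djnOp_mul_star_le_zero (hh : 0 < h) (hε : 0 < ε) (hε2 : ε < 1 / 2) (X Y : Set ℝ)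
    {j k j' k' : ℤ} (hk : 2 ≤ |k - k'|) :
    ‖djnOp h hε M X Y j k * star (djnOp h hε M X Y j' k')‖ ≤ 0 := by
  refine opNorm_le_of_inner_le _ le_rfl fun u v => ?_
  rw [inner_djnOp_mul_star]
  have hk' : 2 ≤ |k' - k| := by rwa [abs_sub_comm]
  exact norm_inner_blockOp_le_zero (M := M) hh hε hε2 1 hk' _ _ u v

/-- **(2.40), vanishing part:** `A_{jk}^* A_{j'k'} = 0` if `|j - j'| ≥ 2`. [cite: DyatlovJinNonnenmacher2021, §2.4, proof of Prop. 2.9, Step 5] -/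
theorem norm_star_djnOp_mul_le_zero (hh : 0 < h) (hε : 0 < ε) (hε2 : ε < 1 / 2) (X Y : Set ℝ)
    {j k j' k' : ℤ} (hj : 2 ≤ |j - j'|) :
    ‖star (djnOp h hε M X Y j k) * djnOp h hε M X Y j' k'‖ ≤ 0 := by
  refine opNorm_le_of_inner_le _ le_rfl fun u v => ?_
  rw [inner_star_djnOp_mul]
  have hj' : 2 ≤ |j' - j| := by rwa [abs_sub_comm]
  exact norm_inner_blockOp_le_zero (M := M) hh hε hε2 (-1) hj' _ _ u v

/-- The constant `C_N(ν) = 2 · (2π)⁻¹ · 2 E_N (18/ν)^N` of (2.39)–(2.40). [cite: DyatlovJinNonnenmacher2021, §2.4, proof of Prop. 2.9, Step 5] -/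
def djnDecayConst (ν : ℝ) (N : ℕ) : ℝ := 2 * ((2 * π)⁻¹ * (2 * blockProdDerivConst N * (18 / ν) ^ N))

/-- `0 ≤ C_N(ν)`. [folklore] -/
theorem djnDecayConst_nonneg {ν : ℝ} (hν : 0 < ν) (N : ℕ) : 0 ≤ djnDecayConst ν N := by
  unfold djnDecayConst
  have := blockProdDerivConst_nonneg N
  positivity

/-- **(2.39):** `‖A_{jk} A_{j'k'}^*‖ ≤ C_N h⁻¹ |j - j'|^{-N}` for `|j - j'| ≥ 3`. [cite: DyatlovJinNonnenmacher2021, §2.4, proof of Prop. 2.9, Step 5, (2.39)] -/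
theorem norm_djnOp_mul_star_le_decay {ν : ℝ} (hν : 0 < ν) (hh : 0 < h) (hh1 : h ≤ 1) (hν1 : ν < 1)
    (hεd : ε = ν * h / 6) (hε : 0 < ε) (X Y : Set ℝ) {j k j' k' : ℤ} (hj : 3 ≤ |j - j'|) (N : ℕ) :
    ‖djnOp h hε M X Y j k * star (djnOp h hε M X Y j' k')‖ ≤
      djnDecayConst ν N * h⁻¹ / |((j - j' : ℤ) : ℝ)| ^ N := by
  have hE := blockProdDerivConst_nonneg N
  have hj' : 3 ≤ |j' - j| := by rwa [abs_sub_comm]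
  have hconst : 2 * ((2 * π * h)⁻¹ * (2 * blockProdDerivConst N * (18 / ν) ^ N / |((j' - j : ℤ) : ℝ)| ^ N)) =
      djnDecayConst ν N * h⁻¹ / |((j - j' : ℤ) : ℝ)| ^ N := by
    have e : |((j' - j : ℤ) : ℝ)| = |((j - j' : ℤ) : ℝ)| := by push_cast; exact abs_sub_comm _ _
    rw [e, djnDecayConst, mul_inv]
    ring
  refine opNorm_le_of_inner_le _ ?_ fun u v => ?_
  · rw [← hconst]; positivity
  rw [inner_djnOp_mul_star, ← hconst]
  exact norm_inner_blockOp_le_decay (M := M) hν hh hh1 hν1 hεd (σ := 1) (by simp) hj' N _ _ u v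

/-- **(2.40):** `‖A_{jk}^* A_{j'k'}‖ ≤ C_N h⁻¹ |k - k'|^{-N}` for `|k - k'| ≥ 3`. [cite: DyatlovJinNonnenmacher2021, §2.4, proof of Prop. 2.9, Step 5, (2.40)] -/
theorem norm_star_djnOp_mul_le_decay {ν : ℝ} (hν : 0 < ν) (hh : 0 < h) (hh1 : h ≤ 1) (hν1 : ν < 1)
    (hεd : ε = ν * h / 6) (hε : 0 < ε) (X Y : Set ℝ) {j k j' k' : ℤ} (hk : 3 ≤ |k - k'|) (N : ℕ) :
    ‖star (djnOp h hε M X Y j k) * djnOp h hε M X Y j' k'‖ ≤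
      djnDecayConst ν N * h⁻¹ / |((k - k' : ℤ) : ℝ)| ^ N := by
  have hE := blockProdDerivConst_nonneg N
  have hk' : 3 ≤ |k' - k| := by rwa [abs_sub_comm]
  have hconst : 2 * ((2 * π * h)⁻¹ * (2 * blockProdDerivConst N * (18 / ν) ^ N / |((k' - k : ℤ) : ℝ)| ^ N)) =
      djnDecayConst ν N * h⁻¹ / |((k - k' : ℤ) : ℝ)| ^ N := by
    have e : |((k' - k : ℤ) : ℝ)| = |((k - k' : ℤ) : ℝ)| := by push_cast; exact abs_sub_comm _ _
    rw [e, djnDecayConst, mul_inv]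
    ring
  refine opNorm_le_of_inner_le _ ?_ fun u v => ?_
  · rw [← hconst]; positivity
  rw [inner_star_djnOp_mul, ← hconst]
  exact norm_inner_blockOp_le_decay (M := M) hν hh hh1 hν1 hεd (σ := -1) (by simp) hk' N _ _ u v

/-- The trivial bounds `‖A_p A_q^*‖, ‖A_p^* A_q‖ ≤ ‖A_p‖ ‖A_q‖`. [folklore] -/
theorem norm_djnOp_mul_star_le_mul (h : ℝ) (hε : 0 < ε) (X Y : Set ℝ) (j k j' k' : ℤ) :
    ‖djnOp h hε M X Y j k * star (djnOp h hε M X Y j' k')‖ ≤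
      ‖djnOp h hε M X Y j k‖ * ‖djnOp h hε M X Y j' k'‖ := by
  refine (norm_mul_le _ _).trans (le_of_eq ?_)
  rw [ContinuousLinearMap.star_eq_adjoint, LinearIsometryEquiv.norm_map]

/-- `‖A_p^* A_q‖ ≤ ‖A_p‖ ‖A_q‖`. [folklore] -/
theorem norm_star_djnOp_mul_le_mul (h : ℝ) (hε : 0 < ε) (X Y : Set ℝ) (j k j' k' : ℤ) :
    ‖star (djnOp h hε M X Y j k) * djnOp h hε M X Y j' k'‖ ≤
      ‖djnOp h hε M X Y j k‖ * ‖djnOp h hε M X Y j' k'‖ := by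
  refine (norm_mul_le _ _).trans (le_of_eq ?_)
  rw [ContinuousLinearMap.star_eq_adjoint, LinearIsometryEquiv.norm_map]

end AlmostOrthogonal

/-! ## Step 3: the Cotlar–Stein sums (2.41)–(2.42) -/

section RowSums

/-- `Z₂ = ∑_{m ∈ ℤ} m⁻²` (with the convention `0⁻¹ = 0`), a numerical constant. [folklore] -/
def zetaTwoInt : ℝ := ∑' m : ℤ, 1 / (m : ℝ) ^ 2

/-- `∑_{m ∈ ℤ} m⁻²` converges. [folklore] -/
theorem summable_one_div_int_sq : Summable fun m : ℤ => 1 / (m : ℝ) ^ 2 :=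
  Real.summable_one_div_int_pow.2 (by norm_num)

/-- `0 ≤ Z₂`. [folklore] -/
theorem zetaTwoInt_nonneg : 0 ≤ zetaTwoInt := tsum_nonneg fun m => by positivity

/-- Finite sub-sums of `∑ m⁻²` are at most `Z₂`. [folklore] -/
theorem sum_one_div_sq_le_zetaTwoInt (S : Finset ℤ) : ∑ m ∈ S, 1 / (m : ℝ) ^ 2 ≤ zetaTwoInt :=
  summable_one_div_int_sq.sum_le_tsum S fun _ _ => by positivity

/-- The one-dimensional Cotlar–Stein weight: `C h^β` for `|m| ≤ R₀` ("we use (2.38) for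
`|j-j'|+|k-k'| ≤ h^{-β/2}`") and `D/m²` beyond ("and (2.39), (2.40) with `N` large for
`|j-j'|+|k-k'| > h^{-β/2}`"). [cite: DyatlovJinNonnenmacher2021, §2.4, proof of Prop. 2.9, Step 3] -/
def djnWeight (C β h D : ℝ) (R₀ : ℕ) (m : ℤ) : ℝ :=
  if |m| ≤ R₀ then C * h ^ β else D / (m : ℝ) ^ 2

/-- `0 ≤ w(m)`. [folklore] -/
theorem djnWeight_nonneg {C β h D : ℝ} (hC : 0 ≤ C) (hh : 0 ≤ h) (hD : 0 ≤ D) (R₀ : ℕ) (m : ℤ) :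
    0 ≤ djnWeight C β h D R₀ m := by
  unfold djnWeight
  split_ifs
  · exact mul_nonneg hC (Real.rpow_nonneg hh _)
  · positivity

/-- `∑_{m ∈ S} w(m) ≤ (2R₀+1) C h^β + D Z₂` for every finite set of integers `S`. [cite: DyatlovJinNonnenmacher2021, §2.4, proof of Prop. 2.9, Step 3, (2.41)–(2.42)] -/
theorem sum_djnWeight_le {C β h D : ℝ} (hC : 0 ≤ C) (hh : 0 ≤ h) (hD : 0 ≤ D) (R₀ : ℕ)
    (S : Finset ℤ) :
    ∑ m ∈ S, djnWeight C β h D R₀ m ≤ (2 * R₀ + 1) * (C * h ^ β) + D * zetaTwoInt := by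
  classical
  rw [← Finset.sum_filter_add_sum_filter_not S (fun m : ℤ => |m| ≤ R₀)]
  refine add_le_add ?_ ?_
  · have hval : ∀ m ∈ S.filter (fun m : ℤ => |m| ≤ R₀), djnWeight C β h D R₀ m = C * h ^ β := by
      intro m hm
      rw [Finset.mem_filter] at hm
      simp [djnWeight, hm.2]
    rw [Finset.sum_congr rfl hval, Finset.sum_const, nsmul_eq_mul]
    refine mul_le_mul_of_nonneg_right ?_ (mul_nonneg hC (Real.rpow_nonneg hh _))
    have hsub : S.filter (fun m : ℤ => |m| ≤ R₀) ⊆ Finset.Icc (-(R₀ : ℤ)) R₀ := by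
      intro m hm
      rw [Finset.mem_filter] at hm
      rw [Finset.mem_Icc]
      exact abs_le.1 hm.2
    have hcard := Finset.card_le_card hsub
    rw [Int.card_Icc, show (R₀ : ℤ) + 1 - -(R₀ : ℤ) = ((2 * R₀ + 1 : ℕ) : ℤ) by push_cast; ring,
      Int.toNat_natCast] at hcard
    exact_mod_cast hcard
  · have hval : ∀ m ∈ S.filter (fun m : ℤ => ¬ |m| ≤ R₀), djnWeight C β h D R₀ m = D * (1 / (m : ℝ) ^ 2) := by
      intro m hm
      rw [Finset.mem_filter] at hm
      simp [djnWeight, hm.2, div_eq_mul_inv]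
    rw [Finset.sum_congr rfl hval, ← Finset.mul_sum]
    exact mul_le_mul_of_nonneg_left (sum_one_div_sq_le_zetaTwoInt _) hD

/-- The Cotlar–Stein weights `a(p, q)` for `‖A_p A_q^*‖` (`p = (j,k)`, `q = (j',k')`): zero if
`|k-k'| ≥ 2`, else `w(j-j')`. [cite: DyatlovJinNonnenmacher2021, §2.4, proof of Prop. 2.9, Step 3, (2.41)] -/
def djnWeightA (C β h D : ℝ) (R₀ : ℕ) (p q : ℤ × ℤ) : ℝ :=
  if 2 ≤ |p.2 - q.2| then 0 else djnWeight C β h D R₀ (p.1 - q.1)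

/-- The Cotlar–Stein weights `b(p, q)` for `‖A_p^* A_q‖`: zero if `|j-j'| ≥ 2`, else `w(k-k')`. [cite: DyatlovJinNonnenmacher2021, §2.4, proof of Prop. 2.9, Step 3, (2.42)] -/
def djnWeightB (C β h D : ℝ) (R₀ : ℕ) (p q : ℤ × ℤ) : ℝ :=
  if 2 ≤ |p.1 - q.1| then 0 else djnWeight C β h D R₀ (p.2 - q.2)

/-- `0 ≤ a(p, q)`. [folklore] -/
theorem djnWeightA_nonneg {C β h D : ℝ} (hC : 0 ≤ C) (hh : 0 ≤ h) (hD : 0 ≤ D) (R₀ : ℕ)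
    (p q : ℤ × ℤ) : 0 ≤ djnWeightA C β h D R₀ p q := by
  unfold djnWeightA; split_ifs
  · exact le_rfl
  · exact djnWeight_nonneg hC hh hD R₀ _

/-- `0 ≤ b(p, q)`. [folklore] -/
theorem djnWeightB_nonneg {C β h D : ℝ} (hC : 0 ≤ C) (hh : 0 ≤ h) (hD : 0 ≤ D) (R₀ : ℕ)
    (p q : ℤ × ℤ) : 0 ≤ djnWeightB C β h D R₀ p q := by
  unfold djnWeightB; split_ifs
  · exact le_rfl
  · exact djnWeight_nonneg hC hh hD R₀ _

/-- At most three integers `k'` have `|k - k'| < 2`. [folklore] -/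
theorem card_filter_abs_sub_lt_two (K : Finset ℤ) (k : ℤ) :
    (K.filter fun k' => ¬ 2 ≤ |k - k'|).card ≤ 3 := by
  have hsub : (K.filter fun k' => ¬ 2 ≤ |k - k'|) ⊆ Finset.Icc (k - 1) (k + 1) := by
    intro k' hk'
    rw [Finset.mem_filter] at hk'
    have h := abs_lt.1 (not_le.1 hk'.2)
    rw [Finset.mem_Icc]
    constructor <;> omega
  refine (Finset.card_le_card hsub).trans ?_
  rw [Int.card_Icc]
  omega

/-- **Row sums of `a`:** `∑_{q ∈ J × K} a(p, q) ≤ 3 ((2R₀+1) C h^β + D Z₂)`. [cite: DyatlovJinNonnenmacher2021, §2.4, proof of Prop. 2.9, Step 3, (2.41)] -/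
theorem sum_djnWeightA_le {C β h D : ℝ} (hC : 0 ≤ C) (hh : 0 ≤ h) (hD : 0 ≤ D) (R₀ : ℕ)
    (J K : Finset ℤ) (p : ℤ × ℤ) :
    ∑ q ∈ J ×ˢ K, djnWeightA C β h D R₀ p q ≤ 3 * ((2 * R₀ + 1) * (C * h ^ β) + D * zetaTwoInt) := by
  classical
  rw [Finset.sum_product]
  have hinner : ∀ j' ∈ J, ∑ k' ∈ K, djnWeightA C β h D R₀ p (j', k') ≤
      3 * djnWeight C β h D R₀ (p.1 - j') := by
    intro j' _
    simp only [djnWeightA]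
    rw [← Finset.sum_filter_add_sum_filter_not K (fun k' : ℤ => 2 ≤ |p.2 - k'|)]
    have h1 : ∑ k' ∈ K.filter (fun k' : ℤ => 2 ≤ |p.2 - k'|),
        (if 2 ≤ |p.2 - k'| then 0 else djnWeight C β h D R₀ (p.1 - j')) = 0 :=
      Finset.sum_eq_zero fun k' hk' => by rw [Finset.mem_filter] at hk'; simp [hk'.2]
    have h2 : ∑ k' ∈ K.filter (fun k' : ℤ => ¬ 2 ≤ |p.2 - k'|),
        (if 2 ≤ |p.2 - k'| then 0 else djnWeight C β h D R₀ (p.1 - j')) =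
          (K.filter (fun k' : ℤ => ¬ 2 ≤ |p.2 - k'|)).card * djnWeight C β h D R₀ (p.1 - j') := by
      rw [Finset.sum_congr rfl (g := fun _ => djnWeight C β h D R₀ (p.1 - j')) fun k' hk' => by
        rw [Finset.mem_filter] at hk'; simp [hk'.2], Finset.sum_const, nsmul_eq_mul]
    rw [h1, h2, zero_add]
    exact mul_le_mul_of_nonneg_right (by exact_mod_cast card_filter_abs_sub_lt_two K p.2)
      (djnWeight_nonneg hC hh hD R₀ _)
  refine (Finset.sum_le_sum hinner).trans ?_
  rw [← Finset.mul_sum]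
  refine mul_le_mul_of_nonneg_left ?_ (by norm_num)
  -- reindex `j' ↦ p.1 - j'`
  have hinj : Set.InjOn (fun j' : ℤ => p.1 - j') J := fun a _ b _ hab => by simpa using hab
  rw [← Finset.sum_image (f := fun m => djnWeight C β h D R₀ m) hinj]
  exact sum_djnWeight_le hC hh hD R₀ _

/-- **Row sums of `b`:** `∑_{q ∈ J × K} b(p, q) ≤ 3 ((2R₀+1) C h^β + D Z₂)`. [cite: DyatlovJinNonnenmacher2021, §2.4, proof of Prop. 2.9, Step 3, (2.42)] -/
theorem sum_djnWeightB_le {C β h D : ℝ} (hC : 0 ≤ C) (hh : 0 ≤ h) (hD : 0 ≤ D) (R₀ : ℕ)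
    (J K : Finset ℤ) (p : ℤ × ℤ) :
    ∑ q ∈ J ×ˢ K, djnWeightB C β h D R₀ p q ≤ 3 * ((2 * R₀ + 1) * (C * h ^ β) + D * zetaTwoInt) := by
  classical
  rw [Finset.sum_product_right]
  have hinner : ∀ k' ∈ K, ∑ j' ∈ J, djnWeightB C β h D R₀ p (j', k') ≤
      3 * djnWeight C β h D R₀ (p.2 - k') := by
    intro k' _
    simp only [djnWeightB]
    rw [← Finset.sum_filter_add_sum_filter_not J (fun j' : ℤ => 2 ≤ |p.1 - j'|)]
    have h1 : ∑ j' ∈ J.filter (fun j' : ℤ => 2 ≤ |p.1 - j'|),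
        (if 2 ≤ |p.1 - j'| then 0 else djnWeight C β h D R₀ (p.2 - k')) = 0 :=
      Finset.sum_eq_zero fun j' hj' => by rw [Finset.mem_filter] at hj'; simp [hj'.2]
    have h2 : ∑ j' ∈ J.filter (fun j' : ℤ => ¬ 2 ≤ |p.1 - j'|),
        (if 2 ≤ |p.1 - j'| then 0 else djnWeight C β h D R₀ (p.2 - k')) =
          (J.filter (fun j' : ℤ => ¬ 2 ≤ |p.1 - j'|)).card * djnWeight C β h D R₀ (p.2 - k') := by
      rw [Finset.sum_congr rfl (g := fun _ => djnWeight C β h D R₀ (p.2 - k')) fun j' hj' => by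
        rw [Finset.mem_filter] at hj'; simp [hj'.2], Finset.sum_const, nsmul_eq_mul]
    rw [h1, h2, zero_add]
    exact mul_le_mul_of_nonneg_right (by exact_mod_cast card_filter_abs_sub_lt_two J p.1)
      (djnWeight_nonneg hC hh hD R₀ _)
  refine (Finset.sum_le_sum hinner).trans ?_
  rw [← Finset.mul_sum]
  refine mul_le_mul_of_nonneg_left ?_ (by norm_num)
  have hinj : Set.InjOn (fun k' : ℤ => p.2 - k') K := fun a _ b _ hab => by simpa using hab
  rw [← Finset.sum_image (f := fun m => djnWeight C β h D R₀ m) hinj]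
  exact sum_djnWeight_le hC hh hD R₀ _

end RowSums

/-! ## The weights dominate the operator norms -/

section Verify

variable {ν β C h ε : ℝ} {M : ℕ} {X Y : Set ℝ}

/-- The decay constant at level `R₀`: `D² = C_N h⁻¹ R₀^{-(N-4)}`, so that
`C_N h⁻¹ |m|^{-N} ≤ (D/m²)²` for `|m| > R₀`. [cite: DyatlovJinNonnenmacher2021, §2.4, proof of Prop. 2.9, Step 3] -/
def djnD (ν h : ℝ) (N R₀ : ℕ) : ℝ := Real.sqrt (djnDecayConst ν N * h⁻¹ * ((R₀ : ℝ) ^ (N - 4))⁻¹)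

/-- `0 ≤ D`. [folklore] -/
theorem djnD_nonneg (ν h : ℝ) (N R₀ : ℕ) : 0 ≤ djnD ν h N R₀ := Real.sqrt_nonneg _

/-- `C_N h⁻¹ |m|^{-N} ≤ (D/m²)²` for `|m| > R₀ ≥ 1`, `N ≥ 4`. [folklore] -/
theorem decay_le_djnD_sq {ν h : ℝ} (hν : 0 < ν) (hh : 0 < h) {N R₀ : ℕ} (hN : 4 ≤ N) (hR : 1 ≤ R₀)
    {m : ℤ} (hm : (R₀ : ℤ) < |m|) :
    djnDecayConst ν N * h⁻¹ / |(m : ℝ)| ^ N ≤ (djnD ν h N R₀ / (m : ℝ) ^ 2) ^ 2 := by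
  have hC2 := djnDecayConst_nonneg hν N
  have hm' : (R₀ : ℝ) < |(m : ℝ)| := by
    have : ((R₀ : ℤ) : ℝ) < ((|m| : ℤ) : ℝ) := by exact_mod_cast hm
    simpa [Int.cast_abs] using this
  have hR' : (1 : ℝ) ≤ R₀ := by exact_mod_cast hR
  have hmpos : 0 < |(m : ℝ)| := by linarith
  rw [div_pow, djnD, Real.sq_sqrt (by positivity)]
  have hm4 : ((m : ℝ) ^ 2) ^ 2 = |(m : ℝ)| ^ 4 := by
    rw [← pow_mul, show 2 * 2 = 4 by norm_num, pow_abs, abs_of_nonneg (by positivity)]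
  rw [hm4, div_le_div_iff₀ (by positivity) (by positivity)]
  -- `C h⁻¹ |m|^4 ≤ C h⁻¹ R₀^{-(N-4)} |m|^N`
  have hkey : |(m : ℝ)| ^ 4 ≤ ((R₀ : ℝ) ^ (N - 4))⁻¹ * |(m : ℝ)| ^ N := by
    rw [le_inv_mul_iff₀ (by positivity)]
    calc (R₀ : ℝ) ^ (N - 4) * |(m : ℝ)| ^ 4 ≤ |(m : ℝ)| ^ (N - 4) * |(m : ℝ)| ^ 4 :=
          mul_le_mul_of_nonneg_right (pow_le_pow_left₀ (by positivity) hm'.le _) (by positivity)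
      _ = |(m : ℝ)| ^ N := by rw [← pow_add, Nat.sub_add_cancel hN]
  calc djnDecayConst ν N * h⁻¹ * |(m : ℝ)| ^ 4
      ≤ djnDecayConst ν N * h⁻¹ * (((R₀ : ℝ) ^ (N - 4))⁻¹ * |(m : ℝ)| ^ N) :=
        mul_le_mul_of_nonneg_left hkey (by positivity)
    _ = djnDecayConst ν N * h⁻¹ * ((R₀ : ℝ) ^ (N - 4))⁻¹ * |(m : ℝ)| ^ N := by ring

/-- **`‖A_p A_q^*‖ ≤ a(p,q)²`.** [cite: DyatlovJinNonnenmacher2021, §2.4, proof of Prop. 2.9, Step 3] -/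
theorem norm_djnOp_mul_star_le_weightA (hν : 0 < ν)
    (HW : ∀ h : ℝ, 0 < h → h ≤ 1 → ∀ j k : ℝ, ∀ X Y : Set ℝ,
      X ⊆ Icc (j - 1) (j + 1) → Y ⊆ Icc (k - 1) (k + 1) →
        IsPorousOnScales X (ν / 3) h 1 → IsPorousOnScales Y (ν / 3) h 1 →
          ∀ u : ℝ → ℂ, Integrable u → MemLp u 2 volume → (∀ x, x ∉ Y → u x = 0) →
            ∫ ξ in X, ‖fourierSemiclassical h u ξ‖ ^ 2 ≤ (C * h ^ β) ^ 2 * ∫ x, ‖u x‖ ^ 2)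
    (hC : 0 ≤ C) (hh : 0 < h) (hh1 : h ≤ 1) (hεd : ε = ν * h / 6) (hε : 0 < ε) (hν1 : ν < 1)
    (hXp : IsPorousOnScales X ν h 1) (hYp : IsPorousOnScales Y ν h 1)
    {N R₀ : ℕ} (hN : 4 ≤ N) (hR : 2 ≤ R₀) (p q : ℤ × ℤ) :
    ‖djnOp h hε M X Y p.1 p.2 * star (djnOp h hε M X Y q.1 q.2)‖ ≤
      djnWeightA C β h (djnD ν h N R₀) R₀ p q ^ 2 := by
  have hε2 : ε < 1 / 2 := by rw [hεd]; nlinarith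
  unfold djnWeightA
  split_ifs with hk
  · rw [sq, mul_zero]
    exact norm_djnOp_mul_star_le_zero (M := M) hh hε hε2 X Y hk
  · unfold djnWeight
    split_ifs with hj
    · refine (norm_djnOp_mul_star_le_mul (M := M) h hε X Y _ _ _ _).trans ?_
      rw [sq]
      exact mul_le_mul (norm_djnOp_le hν HW hC hh hh1 hεd hε hν1 hXp hYp _ _)
        (norm_djnOp_le hν HW hC hh hh1 hεd hε hν1 hXp hYp _ _) (norm_nonneg _)
        (mul_nonneg hC (Real.rpow_nonneg hh.le _))
    · have hj' : (R₀ : ℤ) < |p.1 - q.1| := not_le.1 hj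
      have hj3 : 3 ≤ |p.1 - q.1| := by omega
      refine (norm_djnOp_mul_star_le_decay (M := M) hν hh hh1 hν1 hεd hε X Y hj3 N).trans ?_
      have := decay_le_djnD_sq hν hh hN (by omega) hj'
      simpa [Int.cast_sub] using this

/-- **`‖A_p^* A_q‖ ≤ b(p,q)²`.** [cite: DyatlovJinNonnenmacher2021, §2.4, proof of Prop. 2.9, Step 3] -/
theorem norm_star_djnOp_mul_le_weightB (hν : 0 < ν)
    (HW : ∀ h : ℝ, 0 < h → h ≤ 1 → ∀ j k : ℝ, ∀ X Y : Set ℝ,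
      X ⊆ Icc (j - 1) (j + 1) → Y ⊆ Icc (k - 1) (k + 1) →
        IsPorousOnScales X (ν / 3) h 1 → IsPorousOnScales Y (ν / 3) h 1 →
          ∀ u : ℝ → ℂ, Integrable u → MemLp u 2 volume → (∀ x, x ∉ Y → u x = 0) →
            ∫ ξ in X, ‖fourierSemiclassical h u ξ‖ ^ 2 ≤ (C * h ^ β) ^ 2 * ∫ x, ‖u x‖ ^ 2)
    (hC : 0 ≤ C) (hh : 0 < h) (hh1 : h ≤ 1) (hεd : ε = ν * h / 6) (hε : 0 < ε) (hν1 : ν < 1)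
    (hXp : IsPorousOnScales X ν h 1) (hYp : IsPorousOnScales Y ν h 1)
    {N R₀ : ℕ} (hN : 4 ≤ N) (hR : 2 ≤ R₀) (p q : ℤ × ℤ) :
    ‖star (djnOp h hε M X Y p.1 p.2) * djnOp h hε M X Y q.1 q.2‖ ≤
      djnWeightB C β h (djnD ν h N R₀) R₀ p q ^ 2 := by
  have hε2 : ε < 1 / 2 := by rw [hεd]; nlinarith
  unfold djnWeightB
  split_ifs with hj
  · rw [sq, mul_zero]
    exact norm_star_djnOp_mul_le_zero (M := M) hh hε hε2 X Y hj
  · unfold djnWeight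
    split_ifs with hk
    · refine (norm_star_djnOp_mul_le_mul (M := M) h hε X Y _ _ _ _).trans ?_
      rw [sq]
      exact mul_le_mul (norm_djnOp_le hν HW hC hh hh1 hεd hε hν1 hXp hYp _ _)
        (norm_djnOp_le hν HW hC hh hh1 hεd hε hν1 hXp hYp _ _) (norm_nonneg _)
        (mul_nonneg hC (Real.rpow_nonneg hh.le _))
    · have hk' : (R₀ : ℤ) < |p.2 - q.2| := not_le.1 hk
      have hk3 : 3 ≤ |p.2 - q.2| := by omega
      refine (norm_star_djnOp_mul_le_decay (M := M) hν hh hh1 hν1 hεd hε X Y hk3 N).trans ?_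
      have := decay_le_djnD_sq hν hh hN (by omega) hk'
      simpa [Int.cast_sub] using this

/-- **Step 3, the Cotlar–Stein bound for the finite family `(A_{jk})_{(j,k) ∈ J × K}`:**
`‖∑ A_{jk}‖ ≤ 3 ((2R₀+1) C h^β + D Z₂)`. [cite: DyatlovJinNonnenmacher2021, §2.4, proof of Prop. 2.9, Step 3 ("Now (2.41) and (2.42) imply (2.37) by the Cotlar–Stein Theorem")] -/
theorem norm_sum_djnOp_le (hν : 0 < ν)
    (HW : ∀ h : ℝ, 0 < h → h ≤ 1 → ∀ j k : ℝ, ∀ X Y : Set ℝ,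
      X ⊆ Icc (j - 1) (j + 1) → Y ⊆ Icc (k - 1) (k + 1) →
        IsPorousOnScales X (ν / 3) h 1 → IsPorousOnScales Y (ν / 3) h 1 →
          ∀ u : ℝ → ℂ, Integrable u → MemLp u 2 volume → (∀ x, x ∉ Y → u x = 0) →
            ∫ ξ in X, ‖fourierSemiclassical h u ξ‖ ^ 2 ≤ (C * h ^ β) ^ 2 * ∫ x, ‖u x‖ ^ 2)
    (hC : 0 ≤ C) (hh : 0 < h) (hh1 : h ≤ 1) (hεd : ε = ν * h / 6) (hε : 0 < ε) (hν1 : ν < 1)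
    (hXp : IsPorousOnScales X ν h 1) (hYp : IsPorousOnScales Y ν h 1)
    {N R₀ : ℕ} (hN : 4 ≤ N) (hR : 2 ≤ R₀) (J K : Finset ℤ) :
    ‖∑ p ∈ J ×ˢ K, djnOp h hε M X Y p.1 p.2‖ ≤
      3 * ((2 * R₀ + 1) * (C * h ^ β) + djnD ν h N R₀ * zetaTwoInt) := by
  set D := djnD ν h N R₀ with hDdef
  have hD : 0 ≤ D := djnD_nonneg ν h N R₀
  set Acs : ℝ := 3 * ((2 * R₀ + 1) * (C * h ^ β) + D * zetaTwoInt) with hAcs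
  have hAcs0 : 0 ≤ Acs := by
    have := zetaTwoInt_nonneg
    have : 0 ≤ C * h ^ β := mul_nonneg hC (Real.rpow_nonneg hh.le _)
    positivity
  -- the family indexed by the finite type `↥(J ×ˢ K)`
  have key := cotlarStein_norm_sum_le (ι := ↥(J ×ˢ K))
    (T := fun i => djnOp h hε M X Y i.1.1 i.1.2)
    (a := fun i q => djnWeightA C β h D R₀ i.1 q.1) (b := fun i q => djnWeightB C β h D R₀ i.1 q.1)
    (fun i q => djnWeightA_nonneg hC hh.le hD R₀ _ _) (fun i q => djnWeightB_nonneg hC hh.le hD R₀ _ _)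
    (fun i q => norm_djnOp_mul_star_le_weightA hν HW hC hh hh1 hεd hε hν1 hXp hYp hN hR i.1 q.1)
    (fun i q => norm_star_djnOp_mul_le_weightB hν HW hC hh hh1 hεd hε hν1 hXp hYp hN hR i.1 q.1)
    (A := Acs) (B := Acs)
    (fun i => by
      rw [Finset.sum_coe_sort (J ×ˢ K) (fun q => djnWeightA C β h D R₀ i.1 q)]
      exact sum_djnWeightA_le hC hh.le hD R₀ J K i.1)
    (fun i => by
      rw [Finset.sum_coe_sort (J ×ˢ K) (fun q => djnWeightB C β h D R₀ i.1 q)]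
      exact sum_djnWeightB_le hC hh.le hD R₀ J K i.1)
  rw [Finset.sum_coe_sort (J ×ˢ K) (fun p => djnOp h hε M X Y p.1 p.2), Real.sqrt_mul_self hAcs0] at key
  exact key

end Verify

/-! ## Step 3: the choice of `N` and of the splitting point `R₀ = ⌈h^{-β/2}⌉ + 2` -/

section Constants

/-- `N = 2(⌈1/β⌉ + 3)`, the number of integrations by parts (the printed `N := ⌈8 + 2/β⌉`; any
`N` with `β(N-4) ≥ 2 + 2β` works with the weights used here). [cite: DyatlovJinNonnenmacher2021, §2.4, proof of Prop. 2.9, Step 3 ("with N := ⌈8+2/β⌉")] -/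
def djnN (β : ℝ) : ℕ := 2 * (⌈1 / β⌉₊ + 3)

/-- `R₀ = ⌈h^{-β/2}⌉ + 2`, the splitting point "`|j-j'|+|k-k'| ≤ h^{-β/2}`". [cite: DyatlovJinNonnenmacher2021, §2.4, proof of Prop. 2.9, Step 3] -/
def djnR (β h : ℝ) : ℕ := ⌈h ^ (-β / 2)⌉₊ + 2

/-- The final constant `C(ν) = 3 (9 C + √(C_N) Z₂)`. [cite: DyatlovJinNonnenmacher2021, Proposition 2.9 ("C = C(ν)")] -/
def djnConst (ν β C : ℝ) : ℝ := 3 * (9 * C + Real.sqrt (djnDecayConst ν (djnN β)) * zetaTwoInt)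

/-- `4 ≤ N`. [folklore] -/
theorem four_le_djnN (β : ℝ) : 4 ≤ djnN β := by unfold djnN; omega

/-- `2 ≤ R₀`. [folklore] -/
theorem two_le_djnR (β h : ℝ) : 2 ≤ djnR β h := by unfold djnR; omega

/-- `0 < C(ν)` when `C > 0`. [folklore] -/
theorem djnConst_pos {ν β C : ℝ} (hC : 0 < C) : 0 < djnConst ν β C := by
  unfold djnConst
  have := zetaTwoInt_nonneg
  positivity

/-- **The bookkeeping of Step 3:** `3((2R₀+1) C h^β + D Z₂) ≤ C(ν) h^{β/2}` for `0 < h ≤ 1`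
("we use (2.38) for `|j-j'|+|k-k'| ≤ h^{-β/2}` and (2.39), (2.40) with `N` large for
`|j-j'|+|k-k'| > h^{-β/2}`"). [cite: DyatlovJinNonnenmacher2021, §2.4, proof of Prop. 2.9, Step 3, (2.41)–(2.42)] -/
theorem djn_rowSum_le {ν β C h : ℝ} (hν : 0 < ν) (hβ : 0 < β) (hC : 0 ≤ C) (hh : 0 < h)
    (hh1 : h ≤ 1) :
    3 * ((2 * (djnR β h) + 1) * (C * h ^ β) + djnD ν h (djnN β) (djnR β h) * zetaTwoInt) ≤
      djnConst ν β C * h ^ (β / 2) := by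
  have hZ := zetaTwoInt_nonneg
  have hC2 := djnDecayConst_nonneg hν (djnN β)
  set t : ℝ := h ^ (-β / 2) with ht
  have ht1 : 1 ≤ t := Real.one_le_rpow_of_pos_of_le_one_of_nonpos hh hh1 (by linarith)
  have ht0 : 0 < t := by linarith
  have hR_le : (djnR β h : ℝ) ≤ t + 3 := by
    unfold djnR; push_cast
    have := Nat.ceil_lt_add_one ht0.le
    linarith
  have hR_ge : t ≤ (djnR β h : ℝ) := by
    unfold djnR; push_cast
    exact (Nat.le_ceil _).trans (by linarith)
  have hhb : h ^ β = t⁻¹ * t⁻¹ := by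
    rw [ht, ← Real.rpow_neg hh.le, ← Real.rpow_add hh]; congr 1; ring
  have hhb2 : h ^ (β / 2) = t⁻¹ := by
    rw [ht, ← Real.rpow_neg hh.le]; congr 1; ring
  -- first term: `(2R₀+1) C h^β ≤ 9 C h^{β/2}`
  have h1 : (2 * (djnR β h : ℝ) + 1) * (C * h ^ β) ≤ 9 * C * h ^ (β / 2) := by
    rw [hhb, hhb2]
    have e : 9 * C * t⁻¹ = (9 * t) * (C * (t⁻¹ * t⁻¹)) := by field_simp
    rw [e]
    exact mul_le_mul_of_nonneg_right (by linarith) (by positivity)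
  -- second term: `D ≤ √(C_N) h^{β/2}`
  have h2 : djnD ν h (djnN β) (djnR β h) ≤ Real.sqrt (djnDecayConst ν (djnN β)) * h ^ (β / 2) := by
    unfold djnD
    rw [show Real.sqrt (djnDecayConst ν (djnN β)) * h ^ (β / 2) =
      Real.sqrt (djnDecayConst ν (djnN β) * h ^ β) by
        rw [Real.sqrt_mul hC2, Real.sqrt_eq_rpow (h ^ β), ← Real.rpow_mul hh.le]; ring_nf]
    refine Real.sqrt_le_sqrt ?_
    rw [mul_assoc]
    refine mul_le_mul_of_nonneg_left ?_ hC2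
    -- `h⁻¹ R₀^{-(N-4)} ≤ h⁻¹ t^{-(N-4)} = h^{β(N-4)/2 - 1} ≤ h^β`
    have hN4 : ((djnN β - 4 : ℕ) : ℝ) = 2 * ⌈1 / β⌉₊ + 2 := by
      unfold djnN
      rw [Nat.cast_sub (by omega)]
      push_cast; ring
    have hexp : β ≤ β / 2 * ((djnN β - 4 : ℕ) : ℝ) - 1 := by
      rw [hN4]
      have : 1 / β ≤ ⌈1 / β⌉₊ := Nat.le_ceil _
      have hb : 1 ≤ β * ⌈1 / β⌉₊ := by
        calc (1 : ℝ) = β * (1 / β) := by field_simp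
          _ ≤ β * ⌈1 / β⌉₊ := mul_le_mul_of_nonneg_left this hβ.le
      nlinarith
    calc h⁻¹ * ((djnR β h : ℝ) ^ (djnN β - 4))⁻¹ ≤ h⁻¹ * (t ^ (djnN β - 4))⁻¹ := by
          gcongr
      _ = h ^ (β / 2 * ((djnN β - 4 : ℕ) : ℝ) - 1) := by
          rw [ht, ← Real.rpow_natCast, ← Real.rpow_mul hh.le, ← Real.rpow_neg hh.le,
            ← Real.rpow_neg_one h, ← Real.rpow_add hh]
          congr 1; ring
      _ ≤ h ^ β := Real.rpow_le_rpow_of_exponent_ge hh hh1 hexp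
  calc 3 * ((2 * (djnR β h : ℝ) + 1) * (C * h ^ β) + djnD ν h (djnN β) (djnR β h) * zetaTwoInt)
      ≤ 3 * (9 * C * h ^ (β / 2) + Real.sqrt (djnDecayConst ν (djnN β)) * h ^ (β / 2) * zetaTwoInt) := by
        gcongr
    _ = djnConst ν β C * h ^ (β / 2) := by unfold djnConst; ring

end Constants

/-! ## The bounded case: assembling Steps 1–5 -/

section Bounded

variable {ν β C h : ℝ} {X Y : Set ℝ}

/-- Linearity of `𝓕_h` over a finite sum of bounded cutoffs: `∑_k 𝓕_h(χ_k u) = 𝓕_h((∑_k χ_k) u)`. [folklore] -/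
theorem sum_fourierSemiclassical_blockFun_mul (h ε : ℝ) (M : ℕ) (Y : Set ℝ) (K : Finset ℤ)
    {u : ℝ → ℂ} (hu : Integrable u) (ξ : ℝ) :
    ∑ k ∈ K, fourierSemiclassical h (fun x => blockFun Y ε M k x * u x) ξ =
      fourierSemiclassical h (fun x => (∑ k ∈ K, blockFun Y ε M k x) * u x) ξ := by
  simp only [fourierSemiclassical]
  rw [← Finset.mul_sum, ← integral_finsetSum]
  · congr 1
    refine integral_congr_ae (Eventually.of_forall fun x => ?_)
    simp only [Finset.sum_mul, Finset.mul_sum]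
  · intro k _
    have hint : Integrable (fun x => blockFun Y ε M k x * u x) :=
      hu.bdd_mul (c := 1) (continuous_blockFun Y ε M k).aestronglyMeasurable
        (Eventually.of_forall fun x => norm_blockFun_le_one Y ε M k x)
    refine hint.bdd_mul (c := 1) (Continuous.aestronglyMeasurable (by fun_prop))
      (Eventually.of_forall fun x => le_of_eq ?_)
    rw [show -(Complex.I * (x : ℂ) * (ξ : ℂ) / (h : ℂ)) = ((-(x * ξ / h) : ℝ) : ℂ) * Complex.I by
      push_cast; ring, Complex.norm_exp_ofReal_mul_I]

/-- **DJN Proposition 2.9 for bounded sets, from the window bound** (Steps 1–3 and 5 assembled):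
if `Ω₋ = X`, `Ω₊ = Y ⊆ [-R, R]` are `ν`-porous on scales `h` to `1` (`0 < h ≤ 1`) and `u ∈ L¹ ∩ L²`
vanishes off `Y`, then `∫_X |𝓕_h u|² ≤ (C(ν) h^{β/2})² ∫ |u|²`, with `C(ν)` independent of `R`.
Proof: `𝟙_X 𝓕_h u = 𝟙_X ∑_{j,k} A_{jk} u` pointwise on `X` (the cutoffs equal `1` on `Ω_±`), so
`∫_X |𝓕_h u|² ≤ ‖∑ A_{jk} u‖² ≤ ‖∑ A_{jk}‖² ‖u‖²`, and `‖∑ A_{jk}‖ ≤ C(ν) h^{β/2}` by Cotlar–Stein. [cite: DyatlovJinNonnenmacher2021, §2.4, proof of Prop. 2.9, Steps 1–3 ("The left-hand side of (2.33) is … ≤ ‖χ_- 𝓕_h χ_+‖ … it suffices to show ‖∑ A_{jk}‖ ≤ Ch^β")] -/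
theorem fup_bounded_of_window (hν : 0 < ν) (hν1 : ν < 1) (hβ : 0 < β)
    (HW : ∀ h : ℝ, 0 < h → h ≤ 1 → ∀ j k : ℝ, ∀ X Y : Set ℝ,
      X ⊆ Icc (j - 1) (j + 1) → Y ⊆ Icc (k - 1) (k + 1) →
        IsPorousOnScales X (ν / 3) h 1 → IsPorousOnScales Y (ν / 3) h 1 →
          ∀ u : ℝ → ℂ, Integrable u → MemLp u 2 volume → (∀ x, x ∉ Y → u x = 0) →
            ∫ ξ in X, ‖fourierSemiclassical h u ξ‖ ^ 2 ≤ (C * h ^ β) ^ 2 * ∫ x, ‖u x‖ ^ 2)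
    (hC : 0 ≤ C) (hh : 0 < h) (hh1 : h ≤ 1) (hXm : MeasurableSet X)
    (hXp : IsPorousOnScales X ν h 1) (hYp : IsPorousOnScales Y ν h 1) {R : ℝ}
    (hXR : X ⊆ Icc (-R) R) (hYR : Y ⊆ Icc (-R) R) {u : ℝ → ℂ} (hu1 : Integrable u)
    (hu2 : MemLp u 2 volume) (hu0 : ∀ x, x ∉ Y → u x = 0) :
    ∫ ξ in X, ‖fourierSemiclassical h u ξ‖ ^ 2 ≤
      (djnConst ν β C * h ^ (β / 2)) ^ 2 * ∫ x, ‖u x‖ ^ 2 := by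
  -- the scale `ε = νh/6` and the grid half-width `M`
  set ε : ℝ := ν * h / 6 with hεd
  have hε : 0 < ε := by positivity
  set M : ℕ := ⌈|R| / ε⌉₊ + 1 with hM
  have hMε : |R| < M * ε := by
    rw [hM]; push_cast
    have h1 : |R| / ε ≤ ⌈|R| / ε⌉₊ := Nat.le_ceil _
    rw [div_le_iff₀ hε] at h1
    nlinarith
  have habs : ∀ x ∈ Icc (-R) R, |x| < M * ε := fun x hx =>
    lt_of_le_of_lt (abs_le.2 ⟨by linarith [hx.1, le_abs_self R], hx.2.trans (le_abs_self R)⟩) hMε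
  -- the finite family and its Cotlar–Stein bound
  set J : Finset ℤ := blockIndices X ε M with hJ
  set K : Finset ℤ := blockIndices Y ε M with hK
  set S := ∑ p ∈ J ×ˢ K, djnOp h hε M X Y p.1 p.2 with hS
  have hSnorm : ‖S‖ ≤ djnConst ν β C * h ^ (β / 2) :=
    (norm_sum_djnOp_le (M := M) hν HW hC hh hh1 hεd hε hν1 hXp hYp (four_le_djnN β)
      (two_le_djnR β h) J K).trans (djn_rowSum_le hν hβ hC hh hh1)
  -- the function `G = ∑ χ_j^- 𝓕_h(χ_k^+ u)` represents `S u`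
  set ut : Lp ℂ 2 (volume : Measure ℝ) := hu2.toLp u with hut
  set G : ℝ → ℂ := fun ξ => ∑ p ∈ J ×ˢ K,
    blockFun X ε M p.1 ξ * fourierSemiclassical h (fun x => blockFun Y ε M p.2 x * u x) ξ with hG
  have hSG : ⇑(S ut) =ᵐ[volume] G := by
    have hsum : ⇑(S ut) =ᵐ[volume] ∑ p ∈ J ×ˢ K, ⇑(djnOp h hε M X Y p.1 p.2 ut) := by
      rw [hS, _root_.sum_apply]
      exact Lp.coeFn_finsetSum _ _
    have heach : ∀ p ∈ J ×ˢ K, ⇑(djnOp h hε M X Y p.1 p.2 ut) =ᵐ[volume]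
        fun ξ => blockFun X ε M p.1 ξ * fourierSemiclassical h (fun x => blockFun Y ε M p.2 x * u x) ξ := by
      intro p _
      filter_upwards [kernelOp_coeFn (niceKernel_djnKernel h hε M X Y p.1 p.2) ut] with ξ hξ
      rw [djnOp_eq] at *
      rw [hξ, kernelFun_congr_ae (MemLp.coeFn_toLp hu2), kernelFun_djnKernel]
    have hall := (eventually_all_finset (J ×ˢ K)).2 heach
    filter_upwards [hsum, hall] with ξ h1 h2
    rw [h1, Finset.sum_apply]
    exact Finset.sum_congr rfl fun p hp => h2 p hp
  -- on `X`, `G = 𝓕_h u`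
  have hGX : ∀ ξ ∈ X, G ξ = fourierSemiclassical h u ξ := by
    intro ξ hξ
    have hξ1 : ∑ j ∈ J, blockFun X ε M j ξ = 1 := sum_blockFun_eq_one hε hξ (habs ξ (hXR hξ))
    have hu_eq : (fun x => (∑ k ∈ K, blockFun Y ε M k x) * u x) = u := by
      funext x
      by_cases hx : x ∈ Y
      · rw [sum_blockFun_eq_one hε hx (habs x (hYR hx)), one_mul]
      · rw [hu0 x hx, mul_zero]
    rw [hG]
    simp only
    rw [Finset.sum_product]
    simp_rw [← Finset.mul_sum]
    rw [← Finset.sum_mul, hξ1, one_mul, sum_fourierSemiclassical_blockFun_mul h ε M Y K hu1 ξ, hu_eq]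
  -- integrability of `|G|²` (it is a.e. the square of an `L²` function)
  have hGint : Integrable (fun ξ => ‖G ξ‖ ^ 2) := by
    have h2 : Integrable (fun ξ => ‖(S ut : ℝ → ℂ) ξ‖ ^ 2) :=
      (memLp_two_iff_integrable_sq_norm (Lp.memLp (S ut)).aestronglyMeasurable).1 (Lp.memLp (S ut))
    refine h2.congr ?_
    filter_upwards [hSG] with ξ hξ
    rw [hξ]
  -- conclude
  calc ∫ ξ in X, ‖fourierSemiclassical h u ξ‖ ^ 2 = ∫ ξ in X, ‖G ξ‖ ^ 2 :=
        setIntegral_congr_fun hXm fun ξ hξ => by rw [hGX ξ hξ]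
    _ ≤ ∫ ξ, ‖G ξ‖ ^ 2 := setIntegral_le_integral hGint (Eventually.of_forall fun _ => by positivity)
    _ = ∫ ξ, ‖(S ut : ℝ → ℂ) ξ‖ ^ 2 := by
        refine integral_congr_ae ?_
        filter_upwards [hSG] with ξ hξ
        rw [hξ]
    _ = ‖S ut‖ ^ 2 := (norm_Lp_sq_eq_integral (S ut)).symm
    _ ≤ (‖S‖ * ‖ut‖) ^ 2 := pow_le_pow_left₀ (norm_nonneg _) (S.le_opNorm ut) 2
    _ ≤ (djnConst ν β C * h ^ (β / 2) * ‖ut‖) ^ 2 := by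
        gcongr
    _ = (djnConst ν β C * h ^ (β / 2)) ^ 2 * ∫ x, ‖u x‖ ^ 2 := by
        rw [mul_pow, hut, norm_toLp_sq_eq_integral_norm_sq hu2]

end Bounded

/-! ## From bounded to unbounded sets, and the theorem -/

section Unbounded

/-- Truncations `u 𝟙_{[-m, m]}` converge to `u` in `L¹`, so `𝓕_h (u 𝟙_{[-m,m]}) → 𝓕_h u` pointwise. [folklore] -/
theorem tendsto_fourierSemiclassical_indicator (h : ℝ) {u : ℝ → ℂ} (hu : Integrable u) (ξ : ℝ) :
    Tendsto (fun m : ℕ => fourierSemiclassical h ((Icc (-(m : ℝ)) m).indicator u) ξ) atTop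
      (𝓝 (fourierSemiclassical h u ξ)) := by
  simp only [fourierSemiclassical]
  refine Tendsto.const_mul _ ?_
  -- dominated convergence for `∫ e^{-ixξ/h} 𝟙_{[-m,m]} u`
  have hunit : ∀ x : ℝ, ‖Complex.exp (-(Complex.I * (x : ℂ) * (ξ : ℂ) / (h : ℂ)))‖ = 1 := fun x => by
    rw [show -(Complex.I * (x : ℂ) * (ξ : ℂ) / (h : ℂ)) = ((-(x * ξ / h) : ℝ) : ℂ) * Complex.I by
      push_cast; ring, Complex.norm_exp_ofReal_mul_I]
  refine tendsto_integral_of_dominated_convergence (fun x => ‖u x‖) (fun m => ?_) hu.norm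
    (fun m => Eventually.of_forall fun x => ?_) (Eventually.of_forall fun x => ?_)
  · exact (Continuous.aestronglyMeasurable (by fun_prop)).mul
      ((hu.indicator measurableSet_Icc).aestronglyMeasurable)
  · rw [norm_mul, hunit, one_mul]
    exact norm_indicator_le_norm_self _ _
  · refine Tendsto.const_mul _ ?_
    refine tendsto_const_nhds.congr' ?_
    -- eventually `x ∈ [-m, m]`
    filter_upwards [Filter.eventually_ge_atTop ⌈|x|⌉₊] with m hm
    have hm' : |x| ≤ m := (Nat.le_ceil _).trans (by exact_mod_cast hm)
    rw [indicator_of_mem]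
    exact ⟨by linarith [neg_abs_le x], le_abs_self x |>.trans hm'⟩

/-- **Dyatlov–Jin–Nonnenmacher 2021, Proposition 2.9, from Bourgain–Dyatlov 2018, Theorem 4.**
For `ν ∈ (0, 1)` there are `β(ν), C(ν) > 0` with `‖𝟙_{Ω₋} 𝓕_h 𝟙_{Ω₊}‖_{L² → L²} ≤ C h^β` for all
`0 < h ≤ 1` and all `Ω_± ⊆ ℝ` `ν`-porous on scales `h` to `1` (in the quadratic-form rendering of
`PorousFractalUncertainty.lean`), GIVEN the fractal uncertainty principle for `δ`-regular sets
`bourgainDyatlov2018_thm4`. Proof = the printed Steps 1–5: Step 4 is `porousFUP_window_of_bd18`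
(`PorousFractalUncertaintyProofs.lean`), Steps 1–3 and 5 are `fup_bounded_of_window` for
`Ω_± ⊆ [-R, R]`, and the bound passes to unbounded `Ω_±` (constants independent of `R`) by
`L¹`-truncation of `u` (dominated convergence) and monotone convergence in `Ω₋ ∩ [-n, n]`.
The discharge `dyatlovJinNonnenmacher2021_prop_2_9_holds` is this theorem applied to
`bourgainDyatlov2018_thm4_holds` once the latter lands. [cite: DyatlovJinNonnenmacher2021, Proposition 2.9 and its proof, Steps 1–5] [cite: BourgainDyatlov2018, Theorem 4] -/
theorem dyatlovJinNonnenmacher2021_prop_2_9_of_bd18 (hbd : bourgainDyatlov2018_thm4) :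
    dyatlovJinNonnenmacher2021_prop_2_9 := by
  intro ν hν hν1
  have hν3 : 0 < ν / 3 := by positivity
  have hν31 : ν / 3 < 1 := by linarith
  obtain ⟨β, hβ, C, hC, HW⟩ := porousFUP_window_of_bd18 hbd hν3 hν31
  refine ⟨β / 2, half_pos hβ, djnConst ν β C, djnConst_pos hC, ?_⟩
  intro h hh hh1 X Y hXm hYm hXp hYp u hu1 hu2 hu0
  set c : ℝ := (djnConst ν β C * h ^ (β / 2)) ^ 2 * ∫ x, ‖u x‖ ^ 2 with hc
  have hc0 : 0 ≤ c := mul_nonneg (sq_nonneg _) (integral_nonneg fun _ => by positivity)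
  -- truncated data
  set Xn : ℕ → Set ℝ := fun n => X ∩ Icc (-(n : ℝ)) n with hXn
  set um : ℕ → ℝ → ℂ := fun m => (Icc (-(m : ℝ)) m).indicator u with hum
  -- Step A: the bound for `X_n` and `u_m`
  have hA : ∀ n m : ℕ, ∫ ξ in Xn n, ‖fourierSemiclassical h (um m) ξ‖ ^ 2 ≤ c := by
    intro n m
    set R : ℝ := max (n : ℝ) m with hR
    have hum1 : Integrable (um m) := hu1.indicator measurableSet_Icc
    have hum2 : MemLp (um m) 2 volume := hu2.indicator measurableSet_Icc
    have hum0 : ∀ x, x ∉ Y ∩ Icc (-(m : ℝ)) m → um m x = 0 := by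
      intro x hx
      by_cases hxI : x ∈ Icc (-(m : ℝ)) m
      · have hxY : x ∉ Y := fun hxY => hx ⟨hxY, hxI⟩
        rw [hum]; simp only [indicator_of_mem hxI]; exact hu0 x hxY
      · rw [hum]; simp only [indicator_of_notMem hxI]
    have hXsub : X ∩ Icc (-(n : ℝ)) n ⊆ Icc (-R) R := fun x hx =>
      ⟨by linarith [hx.2.1, le_max_left (n : ℝ) m], hx.2.2.trans (le_max_left _ _)⟩
    have hYsub : Y ∩ Icc (-(m : ℝ)) m ⊆ Icc (-R) R := fun x hx =>
      ⟨by linarith [hx.2.1, le_max_right (n : ℝ) m], hx.2.2.trans (le_max_right _ _)⟩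
    have key := fup_bounded_of_window (X := X ∩ Icc (-(n : ℝ)) n) (Y := Y ∩ Icc (-(m : ℝ)) m)
      hν hν1 hβ HW hC.le hh hh1 (hXm.inter measurableSet_Icc)
      (hXp.mono inter_subset_left) (hYp.mono inter_subset_left) hXsub hYsub hum1 hum2 hum0
    refine key.trans (mul_le_mul_of_nonneg_left ?_ (sq_nonneg _))
    refine integral_mono_of_nonneg (Eventually.of_forall fun _ => by positivity)
      ((memLp_two_iff_integrable_sq_norm hu2.aestronglyMeasurable).1 hu2)
      (Eventually.of_forall fun x => ?_)
    exact pow_le_pow_left₀ (norm_nonneg _) (norm_indicator_le_norm_self _ _) 2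
  -- Step B: `m → ∞` by dominated convergence on the bounded set `X_n`
  have hB : ∀ n : ℕ, ∫ ξ in Xn n, ‖fourierSemiclassical h u ξ‖ ^ 2 ≤ c := by
    intro n
    have hlim : Tendsto (fun m : ℕ => ∫ ξ in Xn n, ‖fourierSemiclassical h (um m) ξ‖ ^ 2) atTop
        (𝓝 (∫ ξ in Xn n, ‖fourierSemiclassical h u ξ‖ ^ 2)) := by
      set B : ℝ := ((2 * π * h) ^ (-(1 / 2 : ℝ)) * ∫ x, ‖u x‖) ^ 2 with hBdef
      refine tendsto_integral_of_dominated_convergence (fun _ => B) (fun m => ?_)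
        (integrableOn_const ((measure_mono inter_subset_right).trans_lt measure_Icc_lt_top).ne)
        (fun m => Eventually.of_forall fun ξ => ?_) (Eventually.of_forall fun ξ => ?_)
      · exact ((continuous_fourierSemiclassical hh (hu1.indicator measurableSet_Icc)).norm.pow 2
          ).aestronglyMeasurable
      · rw [norm_pow, norm_norm, hBdef]
        refine pow_le_pow_left₀ (norm_nonneg _) ((norm_fourierSemiclassical_le hh _ ξ).trans ?_) 2
        refine mul_le_mul_of_nonneg_left ?_ (Real.rpow_nonneg (by positivity) _)
        exact integral_mono (hu1.indicator measurableSet_Icc).norm hu1.norm fun x =>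
          norm_indicator_le_norm_self _ _
      · exact ((tendsto_fourierSemiclassical_indicator h hu1 ξ).norm).pow 2
    exact le_of_tendsto' hlim fun m => hA n m
  -- Step C: `n → ∞` by monotone convergence (if `|𝓕_h u|²` is integrable on `X`; else trivial)
  by_cases hint : IntegrableOn (fun ξ => ‖fourierSemiclassical h u ξ‖ ^ 2) X volume
  · have hmono : Monotone Xn := by
      intro a b hab ξ hξ
      exact ⟨hξ.1, by linarith [hξ.2.1, (Nat.cast_le (α := ℝ)).2 hab],
        hξ.2.2.trans ((Nat.cast_le (α := ℝ)).2 hab)⟩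
    have hUnion : (⋃ n, Xn n) = X := by
      ext ξ
      simp only [mem_iUnion, hXn, mem_inter_iff, mem_Icc]
      constructor
      · rintro ⟨n, hξ, -⟩; exact hξ
      · intro hξ
        refine ⟨⌈|ξ|⌉₊, hξ, ?_, ?_⟩
        · linarith [neg_abs_le ξ, Nat.le_ceil |ξ|]
        · exact (le_abs_self ξ).trans (Nat.le_ceil _)
    have hlim := tendsto_setIntegral_of_monotone (μ := volume)
      (f := fun ξ => ‖fourierSemiclassical h u ξ‖ ^ 2)
      (fun n => hXm.inter measurableSet_Icc) hmono (by rwa [hUnion])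
    rw [hUnion] at hlim
    exact le_of_tendsto' hlim hB
  · rw [integral_undef hint]
    exact hc0

end Unbounded

/-! ## The discharge -/

/-- **Dyatlov–Jin–Nonnenmacher 2021, Proposition 2.9 (fractal uncertainty principle for
`ν`-porous sets) — PROVED.** "For each `ν ∈ (0,1)` there exist `β = β(ν) > 0` and `C = C(ν) > 0`
such that `‖𝟙_{Ω₋} 𝓕_h 𝟙_{Ω₊}‖_{L²(ℝ)→L²(ℝ)} ≤ C h^β` for all `0 < h ≤ 1` and all `Ω_± ⊆ ℝ` which
are `ν`-porous on scales `h` to `1`" (quadratic-form rendering of `PorousFractalUncertainty.lean`):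
the printed reduction (Steps 1–5, `dyatlovJinNonnenmacher2021_prop_2_9_of_bd18`) applied to the
proved Bourgain–Dyatlov theorem `bourgainDyatlov2018_thm4_holds`. [cite: DyatlovJinNonnenmacher2021, Proposition 2.9] [cite: BourgainDyatlov2018, Theorem 4] -/
theorem dyatlovJinNonnenmacher2021_prop_2_9_holds : dyatlovJinNonnenmacher2021_prop_2_9 :=
  dyatlovJinNonnenmacher2021_prop_2_9_of_bd18 bourgainDyatlov2018_thm4_holds

end Literature.Analysis.Fourier
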